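import Literature.MathematicalPhysics.KineticTheory.CollisionTubePairMeanLowerBound
import Literature.MathematicalPhysics.KineticTheory.HardSphereCanonicalPairBound
import HarnessLib

/-!
# The collision-tube functional has the Enskog mean at rung 0 for every bounded mark with a speed
# cutoff (no vanishing at grazing normals), conditionally on the contact hypothesis

Topic `Literature/MathematicalPhysics/KineticTheory` (kind proof; the static TUBE-side estimate of the
Enskog closure at rung 0 for a GENERAL mark, wanted by the crux line `Sketch` of
`InformationPercolationEngine.CollisionRate`, stmt-AtomisticToContinuum-13481, registered stub
`stub_meanEnskogUnitRung0`, whose mark is the speed-truncated UNIT mark `Ξ₁ᴸ(n, v, w) = ψ_L(‖w − v‖)`).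
The sibling files `CollisionTubePairMean`, `CollisionTubeDensityWeight`, `CollisionTubeMeanRung0` prove the
same estimates hard-wired to the truncated even marks `Ξ_L^{kl}`, which vanish at grazing normals
(`⟪n, v − v'⟫ = 0`); here the mark `Ξ` is only assumed continuous (or measurable), bounded by `2L`, and
vanishing at relative speed `‖v − v'‖ ≥ 2L`.  The one new point is that the weak-tube predicate of
`tubeStat` (discriminant `≥ 0`) and the strict tube of `tubeMark` (discriminant `> 0`) differ on GRAZING
pairs only, an event of probability zero under the rung-0 Gibbs law:

* `volume_weakTube_diff_strictTube` — the grazing separations lie on the cylinder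
  `‖w‖²‖q‖² − ⟪q, w⟫² = ‖w‖²`, a Lebesgue-null set (level sets of a degree-two homogeneous function:
  uncountably many disjoint dilates, `Measure.countable_meas_level_set_pos`);
* `localGibbsLaw_grazing_eq_zero`, `ae_localGibbsLaw_weakTube_iff_strictTube` — hence grazing pairs are
  negligible under `G_N` (disintegration over the Maxwellian velocities, the Ruelle-type pair bound
  `posGibbs_pairEvent_le`, `reprSym_# Haar = Lebesgue` on the symmetric cube);
* `tubeStat_one_ae_eq_sum_tubeMark` — the double-sum form of the tube functional, almost surely, for an
  arbitrary mark;
* `abs_integral_tubeMark_sub_le_of_speedCutoff`, `pair_tubeMark_mean_of_speedCutoff`,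
  `integral_sum_densityWeight_tubeMark_le_of_speedCutoff`, `abs_integral_tubeStat_sub_le_of_speedCutoff` —
  the pair-level and fixed-time tube means under the contact hypothesis (proofs adapted verbatim from the
  sibling files, the grazing hypothesis replaced by the almost-sure double-sum form);
* `forall_abs_integral_tubeStat_sub_le_of_contact` — the bookkeeping of thresholds (`ζ`, `κ₀`, the continuity
  modulus of `g`, `N₀`) turning the fixed-time estimate into an `η/τ`-bound uniformly in `t ∈ [0, τ]`, and
  `abs_setIntegral_sub_mul_setIntegral_le_of_forall` — its time integration.

References: C. Cercignani, R. Illner, M. Pulvirenti (1994) §2.2, App. 4.A [CIPDiluteGases1994];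
H. van Beijeren, M. H. Ernst, Physica 68 (1973) [VanbeijerenErnst1973]; H. Spohn (1991) Part I §2.3 [Spohn1991];
D. Ruelle, *Statistical Mechanics: Rigorous Results* (1969) §4.2 [Ruelle1969].
-/

noncomputable section

namespace Literature.MathematicalPhysics.KineticTheory

open _root_.MeasureTheory _root_.ProbabilityTheory Set Filter _root_.Topology Function
open scoped ENNReal BigOperators InnerProductSpace Pointwise
open Literature.Analysis.FluidPDE

/-! ## The grazing part of the weak tube is Lebesgue-null -/

/-- The unit level set of a measurable function on `ℝ³` which is homogeneous of degree two under
dilations is Lebesgue-null (its positive dilates are uncountably many disjoint level sets of positive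
measure otherwise). [folklore] -/
theorem volume_levelSet_one_eq_zero_of_homogeneous {g : V3 → ℝ} (hg : Measurable g)
    (hhom : ∀ (c : ℝ) (q : V3), g (c • q) = c ^ 2 * g q) :
    volume {q : V3 | g q = 1} = 0 := by
  by_contra h0
  have hpos : 0 < volume {q : V3 | g q = 1} := pos_iff_ne_zero.2 h0
  have hlevel : ∀ c : ℝ, 0 < c → {q : V3 | g q = c ^ 2} = c • {q : V3 | g q = 1} := by
    intro c hc
    ext q
    rw [mem_smul_set_iff_inv_smul_mem₀ hc.ne', mem_setOf_eq, mem_setOf_eq, hhom, inv_pow,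
      inv_mul_eq_div, div_eq_one_iff_eq (pow_ne_zero 2 hc.ne')]
  have hposc : ∀ c : ℝ, 0 < c → 0 < volume {q : V3 | g q = c ^ 2} := by
    intro c hc
    rw [hlevel c hc, Measure.addHaar_smul_of_nonneg volume hc.le]
    exact ENNReal.mul_pos (ENNReal.ofReal_pos.2 (pow_pos hc _)).ne' hpos.ne'
  have hcount := Measure.countable_meas_level_set_pos (μ := (volume : Measure V3)) hg
  have hsub : Ioi (0 : ℝ) ⊆ {t : ℝ | 0 < volume {q : V3 | g q = t}} := by
    intro t ht
    have h := hposc (Real.sqrt t) (Real.sqrt_pos.2 ht)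
    rwa [Real.sq_sqrt (le_of_lt ht)] at h
  have hIoi : ¬ (Ioi (0 : ℝ)).Countable := by
    intro hc
    have h2 := Cardinal.le_aleph0_iff_set_countable.2 hc
    rw [Cardinal.mk_Ioi_real 0] at h2
    exact Cardinal.aleph0_lt_continuum.not_ge h2
  exact hIoi (hcount.mono hsub)

/-- **The weak tube exceeds the strict tube by a Lebesgue-null set**: the grazing separations (zero
discriminant) lie on the cylinder `‖w‖²‖q‖² − ⟪q, w⟫² = ‖w‖²` tangent to the unit sphere along `w`.
[cite: CIPDiluteGases1994, §2.2] -/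
theorem volume_weakTube_diff_strictTube (κ : ℝ) (w : V3) :
    volume (weakTube κ w \ strictTube κ w) = 0 := by
  by_cases hw : w = 0
  · have he : weakTube κ w \ strictTube κ w = ∅ := by
      ext q
      simp only [Set.mem_sdiff, weakTube, mem_setOf_eq, hw, inner_zero_right, lt_self_iff_false, false_and,
        and_false, mem_empty_iff_false, false_and]
    rw [he, measure_empty]
  set g : V3 → ℝ := fun q => ‖w‖ ^ 2 * ‖q‖ ^ 2 - ⟪q, w⟫_ℝ ^ 2 with hgdef
  have hgm : Measurable g := by fun_prop
  have hhom : ∀ (c : ℝ) (q : V3), g (c • q) = c ^ 2 * g q := by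
    intro c q
    simp only [hgdef, norm_smul, real_inner_smul_left, mul_pow, Real.norm_eq_abs, sq_abs]
    ring
  have h1 : volume {q : V3 | g q = 1} = 0 := volume_levelSet_one_eq_zero_of_homogeneous hgm hhom
  have hwpos : 0 < ‖w‖ := norm_pos_iff.2 hw
  have hlevel : {q : V3 | g q = ‖w‖ ^ 2} = ‖w‖ • {q : V3 | g q = 1} := by
    ext q
    rw [mem_smul_set_iff_inv_smul_mem₀ hwpos.ne', mem_setOf_eq, mem_setOf_eq, hhom, inv_pow,
      inv_mul_eq_div, div_eq_one_iff_eq (pow_ne_zero 2 hwpos.ne')]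
  have hsub : weakTube κ w \ strictTube κ w ⊆ {q : V3 | g q = ‖w‖ ^ 2} := by
    rintro q ⟨⟨hq1, hq2, hq3, hq4⟩, hqs⟩
    have hnot : ¬ (‖w‖ ^ 2 * (‖q‖ ^ 2 - 1) < ⟪q, w⟫_ℝ ^ 2) := fun h => hqs ⟨hq1, hq2, h, hq4⟩
    have heq : ‖w‖ ^ 2 * (‖q‖ ^ 2 - 1) = ⟪q, w⟫_ℝ ^ 2 := le_antisymm hq3 (not_lt.1 hnot)
    simp only [mem_setOf_eq, hgdef]
    linarith
  refine measure_mono_null hsub ?_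
  rw [hlevel, Measure.addHaar_smul_of_nonneg volume hwpos.le, h1, mul_zero]

/-- The weak tube of a fixed relative velocity is measurable. [folklore] -/
theorem measurableSet_weakTube (κ : ℝ) (w : V3) : MeasurableSet (weakTube κ w) :=
  (measurableSet_weakTube₂ κ).preimage (measurable_const.prodMk measurable_id :
    Measurable fun q : V3 => (w, q))

/-! ## Grazing pairs are negligible under the rung-0 Gibbs law -/

/-- **Lebesgue-null sets of rescaled separations are null for the canonical pair law** (small reduced
density, `N ≥ 1`, `i ≠ j`): `P_N{ε⁻¹ reprSym (xᵢ − xⱼ) ∈ S} = 0` whenever `vol S = 0` (the Ruelle-type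
pair bound `posGibbs_pairEvent_le`, `reprSym_# Haar = Lebesgue` on the symmetric cube, and scaling).
[folklore] -/
theorem posGibbs_sep_mem_eq_zero {σ : ℝ} (hsd : SmallDensity uniformProfile σ) {N : ℕ} (hN : 1 ≤ N)
    {i j : Fin (N + 1)} (hij : i ≠ j) {S : Set V3} (hSm : MeasurableSet S) (hS0 : volume S = 0) :
    posGibbsMeasure (fun _ : T3 => (1 : ℝ)) (hsDiameter σ N) (N + 1)
      {x | (hsDiameter σ N)⁻¹ • Torus.reprSym (x i - x j) ∈ S} = 0 := by
  have hε : 0 < hsDiameter σ N := hsDiameter_pos hsd.σ_pos N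
  set B : Set V3 := (fun q => (hsDiameter σ N)⁻¹ • q) ⁻¹' S with hB
  have hBm : MeasurableSet B := (measurable_const_smul _) hSm
  have hB0 : volume B = 0 := by
    rw [hB, Measure.addHaar_preimage_smul volume (inv_ne_zero hε.ne') S, hS0, mul_zero]
  set T : Set T3 := Torus.reprSym ⁻¹' B with hT
  have hTm : MeasurableSet T := Torus.measurable_reprSym hBm
  have hT0 : volume T = 0 := by
    rw [hT, ← Measure.map_apply Torus.measurable_reprSym hBm, Torus.map_reprSym_volume,
      Measure.restrict_apply hBm]
    exact measure_mono_null inter_subset_left hB0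
  have hset : {x : Fin (N + 1) → T3 | (hsDiameter σ N)⁻¹ • Torus.reprSym (x i - x j) ∈ S} =
      {x | x i - x j ∈ T} := rfl
  rw [hset]
  refine le_antisymm ((posGibbs_pairEvent_le hsd hN hij hTm).trans ?_) bot_le
  rw [hT0, mul_zero]

/-- **Grazing pairs have probability zero at rung 0.**  Under the homogeneous canonical Gibbs law of
constant profiles (small reduced density, `N ≥ 1`), for `i ≠ j` the rescaled separation
`ε⁻¹ reprSym (xᵢ − xⱼ)` almost never lies in the grazing part `weakTube ∖ strictTube` of the tube of the
relative velocity `vᵢ − vⱼ` (disintegration over the Maxwellian velocities, `posGibbs_sep_mem_eq_zero`,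
`volume_weakTube_diff_strictTube`). [folklore] -/
theorem localGibbsLaw_grazing_eq_zero {σ a θ : ℝ} {u : V3} {N : ℕ}
    (Φ : HardSphereFlow (Torus.geometry (Fin 3)) (hsDiameter σ N) (N + 1))
    (hsd : SmallDensity uniformProfile σ) (hN : 1 ≤ N) (ha : 0 < a) (hθ : 0 < θ) (κ : ℝ)
    {i j : Fin (N + 1)} (hij : i ≠ j) :
    localGibbsLaw σ (fun _ => a) (fun _ => u) (fun _ => θ) N Φ
      {z | (hsDiameter σ N)⁻¹ • Torus.reprSym ((z i).1 - (z j).1) ∈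
        weakTube κ ((z i).2 - (z j).2) \ strictTube κ ((z i).2 - (z j).2)} = 0 := by
  have hDm : MeasurableSet {p : V3 × V3 | p.2 ∈ weakTube κ p.1 \ strictTube κ p.1} := by
    have h1 := measurableSet_weakTube₂ (E := V3) κ
    have h2 := measurableSet_strictTube₂ (E := V3) κ
    have e : {p : V3 × V3 | p.2 ∈ weakTube κ p.1 \ strictTube κ p.1} =
        {p : V3 × V3 | p.2 ∈ weakTube κ p.1} \ {p : V3 × V3 | p.2 ∈ strictTube κ p.1} := by
      ext p; simp only [mem_setOf_eq, Set.mem_sdiff]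
    rw [e]
    exact h1.diff h2
  -- measurability of the event (compositions elaborated without expected type)
  have hwm : Measurable fun z : Config (N + 1) (Fin 3) T3 => (z i).2 - (z j).2 :=
    (measurable_pi_apply i).snd.sub (measurable_pi_apply j).snd
  have hqm := (measurable_sep (hsDiameter σ N) i j).comp
    (measurable_pi_lambda _ fun m => (measurable_pi_apply m).fst :
      Measurable fun z : Config (N + 1) (Fin 3) T3 => fun m => (z m).1)
  have hEm := (hwm.prodMk hqm) hDm
  have hEeq : {z : Config (N + 1) (Fin 3) T3 | (hsDiameter σ N)⁻¹ • Torus.reprSym ((z i).1 - (z j).1) ∈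
      weakTube κ ((z i).2 - (z j).2) \ strictTube κ ((z i).2 - (z j).2)} =
      (fun z : Config (N + 1) (Fin 3) T3 => ((z i).2 - (z j).2,
        ((fun x : Fin (N + 1) → T3 => (hsDiameter σ N)⁻¹ • Torus.reprSym (x i - x j)) ∘
          fun z : Config (N + 1) (Fin 3) T3 => fun m => (z m).1) z)) ⁻¹'
        {p : V3 × V3 | p.2 ∈ weakTube κ p.1 \ strictTube κ p.1} := rfl
  haveI : IsProbabilityMeasure (posGibbsMeasure (fun _ : T3 => a) (hsDiameter σ N) (N + 1)) :=
    isProbabilityMeasure_posGibbsMeasure continuous_const (fun _ => ha) hsd.σ_lt_half.le N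
  rw [hEeq, localGibbsLaw_eq, localGibbsMeasure_rung0_eq_map σ ha.le hθ u N,
    Measure.map_apply measurable_zipConfig hEm, Measure.prod_apply_symm (measurable_zipConfig hEm)]
  -- for fixed velocities the position event is null
  refine (lintegral_congr fun v => ?_).trans lintegral_zero
  have hset : (fun x : Fin (N + 1) → T3 => (x, v)) ⁻¹' (zipConfig ⁻¹' ((fun z : Config (N + 1) (Fin 3) T3 =>
      ((z i).2 - (z j).2, ((fun x : Fin (N + 1) → T3 => (hsDiameter σ N)⁻¹ • Torus.reprSym (x i - x j)) ∘
        fun z : Config (N + 1) (Fin 3) T3 => fun m => (z m).1) z)) ⁻¹'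
        {p : V3 × V3 | p.2 ∈ weakTube κ p.1 \ strictTube κ p.1})) =
      {x | (hsDiameter σ N)⁻¹ • Torus.reprSym (x i - x j) ∈
        weakTube κ (v i - v j) \ strictTube κ (v i - v j)} := by
    ext x
    simp only [mem_preimage, Function.comp_apply, zipConfig_apply, mem_setOf_eq]
  have hDv0 : volume (weakTube κ (v i - v j) \ strictTube κ (v i - v j)) = 0 :=
    volume_weakTube_diff_strictTube κ _
  have hDvm : MeasurableSet (weakTube κ (v i - v j) \ strictTube κ (v i - v j)) :=
    (measurableSet_weakTube κ _).diff (measurableSet_strictTube κ _)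
  rw [hset, posGibbsMeasure_const_eq_one ha]
  exact posGibbs_sep_mem_eq_zero hsd hN hij hDvm hDv0

/-- **Almost surely no pair grazes**: off a null set of the rung-0 Gibbs law, for every ordered pair
`i ≠ j` the rescaled separation lies in the weak tube of the relative velocity iff it lies in the
strict tube. [folklore] -/
theorem ae_localGibbsLaw_weakTube_iff_strictTube {σ a θ : ℝ} {u : V3} {N : ℕ}
    (Φ : HardSphereFlow (Torus.geometry (Fin 3)) (hsDiameter σ N) (N + 1))
    (hsd : SmallDensity uniformProfile σ) (hN : 1 ≤ N) (ha : 0 < a) (hθ : 0 < θ) (κ : ℝ) :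
    ∀ᵐ z ∂(localGibbsLaw σ (fun _ => a) (fun _ => u) (fun _ => θ) N Φ), ∀ i j : Fin (N + 1), i ≠ j →
      ((hsDiameter σ N)⁻¹ • Torus.reprSym ((z i).1 - (z j).1) ∈ weakTube κ ((z i).2 - (z j).2) ↔
        (hsDiameter σ N)⁻¹ • Torus.reprSym ((z i).1 - (z j).1) ∈ strictTube κ ((z i).2 - (z j).2)) := by
  rw [ae_all_iff]
  intro i
  rw [ae_all_iff]
  intro j
  by_cases hij : i ≠ j
  · have h := measure_eq_zero_iff_ae_notMem.1 (localGibbsLaw_grazing_eq_zero (u := u) Φ hsd hN ha hθ κ hij)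
    filter_upwards [h] with z hz
    intro _
    refine ⟨fun hw => ?_, fun hs => strictTube_subset_weakTube κ _ hs⟩
    by_contra hs
    exact hz ⟨hw, hs⟩
  · exact ae_of_all _ fun z h => absurd h hij

/-! ## The tube functional at level `1` as a double sum of tube marks, almost surely -/

/-- **The tube functional at level `1` is almost surely the weighted double sum of tube marks**, for an
ARBITRARY mark (no vanishing at grazing normals is needed):
`tubeStat σ N χ g Ξ r ϑ 1 κ t z = ((N+1)κ)⁻¹ Σ_{i ≠ j} χ(t,xᵢ) g(σ³ ρ̃_r(x,xᵢ)) tubeMark κ Ξ (ε⁻¹ sepVec xᵢ xⱼ) vᵢ vⱼ`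
for all `t`, for almost every `z` under the rung-0 Gibbs law (the weak-tube predicate of `tubeStat` and the
strict tube of `tubeMark` differ only on grazing pairs, `ae_localGibbsLaw_weakTube_iff_strictTube`).
[folklore] -/
theorem tubeStat_one_ae_eq_sum_tubeMark {σ a θ : ℝ} {u : V3} {N : ℕ}
    (Φ : HardSphereFlow (Torus.geometry (Fin 3)) (hsDiameter σ N) (N + 1))
    (hsd : SmallDensity uniformProfile σ) (hN : 1 ≤ N) (ha : 0 < a) (hθ : 0 < θ)
    (χ : ℝ × UnitAddTorus (Fin 3) → ℝ) (g : ℝ → ℝ) (Ξ : V3 × V3 × V3 → ℝ) (r ϑ κ : ℝ) :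
    ∀ᵐ z ∂(localGibbsLaw σ (fun _ => a) (fun _ => u) (fun _ => θ) N Φ), ∀ t : ℝ,
      tubeStat σ N χ g Ξ r ϑ 1 κ t z = ((N + 1 : ℝ) * κ)⁻¹ * ∑ i, ∑ j,
        if i ≠ j then χ (t, (z i).1) * g (σ ^ 3 * empDensity r (fun m => (z m).1) (z i).1) *
          tubeMark κ Ξ ((hsDiameter σ N)⁻¹ • Torus.reprSym ((z i).1 - (z j).1)) (z i).2 (z j).2 else 0 := by
  have hε : 0 < hsDiameter σ N := hsDiameter_pos hsd.σ_pos N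
  filter_upwards [ae_localGibbsLaw_weakTube_iff_strictTube Φ hsd hN ha hθ κ] with z hz
  intro t
  rw [tubeStat_one_eq]
  congr 1
  refine Finset.sum_congr rfl fun i _ => Finset.sum_congr rfl fun j _ => ?_
  unfold tubeTerm
  by_cases hij : i ≠ j
  · rw [if_pos hij]
    have hq : sepAt z i j = Torus.reprSym ((z i).1 - (z j).1) := rfl
    have hw : relVel z i j = (z i).2 - (z j).2 := rfl
    by_cases hP : hsDiameter σ N < ‖sepAt z i j‖ ∧ ⟪sepAt z i j, relVel z i j⟫_ℝ < 0 ∧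
        ‖relVel z i j‖ ^ 2 * (‖sepAt z i j‖ ^ 2 - hsDiameter σ N ^ 2) ≤ ⟪sepAt z i j, relVel z i j⟫_ℝ ^ 2 ∧
        hitTime (hsDiameter σ N) (sepAt z i j) (relVel z i j) ≤ κ * hsDiameter σ N
    · have hmem : (hsDiameter σ N)⁻¹ • sepAt z i j ∈ weakTube κ (relVel z i j) := by
        rw [← tubePred_iff_smul_mem_weakTube hε]
        exact hP
      rw [hq, hw] at hmem
      have hmem' := (hz i j hij).1 hmem
      rw [if_pos ⟨hij, hP⟩, tubeMark, if_pos hmem', weightAt, mollDensity_eq_empDensity, hitTime,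
        impactNormal_scale hε]
      rfl
    · have hmem : (hsDiameter σ N)⁻¹ • Torus.reprSym ((z i).1 - (z j).1) ∉
          strictTube κ ((z i).2 - (z j).2) := by
        intro h
        have hw' := (hz i j hij).2 h
        rw [← hq, ← hw, ← tubePred_iff_smul_mem_weakTube hε] at hw'
        exact hP hw'
      rw [if_neg (fun h => hP h.2), tubeMark, if_neg hmem, mul_zero]
  · rw [if_neg hij, if_neg (fun h => hij h.1)]

/-! ## The position average of the tube mark under the contact hypothesis -/

/-- **The configurational average of the tube mark of one pair, under the contact hypothesis** (any measurable mark `Ξ` with `|Ξ| ≤ 2L` vanishing at relative speed `≥ 2L`).  If the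
law of `ε⁻¹ reprSym (xᵢ − xⱼ)` under a finite measure `P` on positions satisfies
`|P{reprSym (xᵢ − xⱼ) ∈ ε S} − c vol(S)| ≤ e vol(S)` for all measurable `S` in the shell
`1 < ‖q‖ ≤ 1 + δ`, and `2Lκ ≤ δ`, then for all velocities `v, v'`:
`|∫ tubeMark κ Ξ (ε⁻¹ reprSym (xᵢ − xⱼ)) v v' dP − c κ Θ Ξ v v'| ≤ e κ · 4L² |S²|`
(the strict tube of a pair of relative speed `< 2L` lies in the shell and has volume `≤ κ · 2L · |S²|`;
`abs_setIntegral_sub_mul_setIntegral_le`, `integral_tubeMark`; at larger relative speed the mark vanishes).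
[folklore] -/
theorem abs_integral_tubeMark_sub_le_of_speedCutoff {n : ℕ} (P : Measure (Fin n → T3)) [IsFiniteMeasure P]
    {ε : ℝ} (hε : 0 < ε) (i j : Fin n) {Ξ : V3 × V3 × V3 → ℝ} (hΞm : Measurable Ξ) {L κ δ c e : ℝ}
    (hΞb : ∀ p, |Ξ p| ≤ 2 * L) (hΞL : ∀ m v v' : V3, 2 * L ≤ ‖v - v'‖ → Ξ (m, v, v') = 0)
    (hL : 0 ≤ L) (hκ : 0 ≤ κ) (he : 0 ≤ e) (hLκδ : 2 * L * κ ≤ δ)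
    (hC : ∀ S : Set V3, MeasurableSet S → S ⊆ {q | 1 < ‖q‖ ∧ ‖q‖ ≤ 1 + δ} →
      |P.real {x | Torus.reprSym (x i - x j) ∈ ε • S} - c * (volume : Measure V3).real S| ≤
        e * (volume : Measure V3).real S)
    (v v' : V3) :
    |(∫ x, tubeMark κ Ξ (ε⁻¹ • Torus.reprSym (x i - x j)) v v' ∂P) -
        c * κ * sphereMark Ξ v v'| ≤
      e * κ * (2 * L * (2 * L) * (sphereMeasure : Measure (Metric.sphere (0 : V3) 1)).real univ) := by
  set σS := (sphereMeasure : Measure (Metric.sphere (0 : V3) 1)).real univ with hσS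
  have hσS0 : 0 ≤ σS := measureReal_nonneg
  have hR₀ : 0 ≤ e * κ * (2 * L * (2 * L) * σS) := by positivity
  set w := v - v' with hw
  by_cases hwL : ‖w‖ < 2 * L
  · -- the strict tube and the reduced mark
    set T := strictTube κ w with hT
    have hTm : MeasurableSet T := measurableSet_strictTube κ w
    set h : V3 → ℝ := fun q => Ξ (impactNormal w q, v, v') with hh
    have hhm : Measurable h := hΞm.comp ((measurable_impactNormal w).prodMk measurable_const)
    have hhb : ∀ q, |h q| ≤ 2 * L := fun q => hΞb _
    have hind : (fun q => tubeMark κ Ξ q v v') = T.indicator h := tubeMark_eq_indicator κ Ξ v v'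
    -- the law of the rescaled separation
    set ν : Measure V3 := P.map fun x => ε⁻¹ • Torus.reprSym (x i - x j) with hν
    haveI : IsFiniteMeasure ν := by rw [hν]; infer_instance
    have hI : ∫ x, tubeMark κ Ξ (ε⁻¹ • Torus.reprSym (x i - x j)) v v' ∂P = ∫ q in T, h q ∂ν := by
      rw [← integral_indicator hTm, ← hind, hν,
        integral_map (measurable_sep ε i j).aemeasurable (measurable_tubeMark_left κ hΞm _ _).aestronglyMeasurable]
    have hLeb : ∫ q in T, h q = κ * sphereMark Ξ v v' := by
      rw [← integral_indicator hTm, ← hind, integral_tubeMark_eq_mul_sphereMark hκ hΞm]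
    -- the tube lies in the shell
    have hTsub : T ⊆ {q : V3 | 1 < ‖q‖ ∧ ‖q‖ ≤ 1 + δ} := fun q hq => by
      obtain ⟨h1, h2⟩ := strictTube_subset_shell κ w hq
      refine ⟨h1, h2.trans ?_⟩
      have : κ * ‖w‖ ≤ κ * (2 * L) := mul_le_mul_of_nonneg_left hwL.le hκ
      linarith
    -- the hypothesis, transported to `ν`
    have hCS : ∀ S, MeasurableSet S → S ⊆ T →
        |ν.real S - c * (volume : Measure V3).real S| ≤ e * (volume : Measure V3).real S := by
      intro S hS hST
      have hconv : ν.real S = P.real {x | Torus.reprSym (x i - x j) ∈ ε • S} := by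
        rw [measureReal_def, measureReal_def, hν, Measure.map_apply (measurable_sep ε i j) hS]
        congr 1
        congr 1
        ext x
        simp only [mem_preimage, mem_setOf_eq, mem_smul_set_iff_inv_smul_mem₀ hε.ne']
      rw [hconv]
      exact hC S hS (hST.trans hTsub)
    have hfinν : ν T ≠ ∞ := measure_ne_top _ _
    have hfinμ : (volume : Measure V3) T ≠ ∞ := by
      haveI := isFiniteMeasure_sphereMeasure (E := V3)
      refine ((measure_strictTube_le (volume : Measure V3) hκ w).trans_lt ?_).ne
      exact ENNReal.mul_lt_top ENNReal.ofReal_lt_top (measure_lt_top _ _)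
    have hM := abs_setIntegral_sub_mul_setIntegral_le hTm hfinν hfinμ hCS hhm hhb
    -- the error integral
    have hvol : ∫ q in T, |h q| ≤ 2 * L * (κ * (2 * L) * σS) := by
      have h1 : ∫ q in T, |h q| ≤ 2 * L * (volume : Measure V3).real T := by
        have h' := norm_setIntegral_le_of_norm_le_const (μ := (volume : Measure V3)) (s := T)
          (f := fun q => |h q|) (C := 2 * L) hfinμ.lt_top (fun q _ => by
            rw [Real.norm_eq_abs, abs_abs]; exact hhb q)
        exact (le_abs_self _).trans (by simpa only [Real.norm_eq_abs] using h')
      have h2 : (volume : Measure V3).real T ≤ κ * (2 * L) * σS :=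
        (volume_real_strictTube_le hκ w).trans
          (mul_le_mul_of_nonneg_right (mul_le_mul_of_nonneg_left hwL.le hκ) hσS0)
      exact h1.trans (mul_le_mul_of_nonneg_left h2 (by positivity))
    rw [hI]
    rw [hLeb] at hM
    calc |(∫ q in T, h q ∂ν) - c * κ * sphereMark Ξ v v'|
        = |(∫ q in T, h q ∂ν) - c * (κ * sphereMark Ξ v v')| := by ring_nf
      _ ≤ e * ∫ q in T, |h q| := hM
      _ ≤ e * (2 * L * (κ * (2 * L) * σS)) := mul_le_mul_of_nonneg_left hvol he
      _ = e * κ * (2 * L * (2 * L) * σS) := by ring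
  · -- large relative speed: the mark vanishes identically
    push Not at hwL
    have hΞ0 : ∀ m : V3, Ξ (m, v, v') = 0 := fun m => hΞL m v v' hwL
    have h0 : ∀ x : Fin n → T3, tubeMark κ Ξ (ε⁻¹ • Torus.reprSym (x i - x j)) v v' = 0 := fun x => by
      simp only [tubeMark, hΞ0, ite_self]
    have hΘ0 : sphereMark Ξ v v' = 0 := by
      simp only [sphereMark, hΞ0, zero_mul, integral_zero]
    simp only [h0, integral_zero, hΘ0, mul_zero, sub_zero, abs_zero]
    exact hR₀

/-! ## The pair-level tube mean under the contact hypothesis -/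

/-- **One ordered pair has the Enskog tube mean at rung 0, conditionally on the contact hypothesis** (any continuous mark `Ξ`, `|Ξ| ≤ 2L`, vanishing at relative speed `≥ 2L`).
For constant profiles `a, θ > 0`, `u`, `0 < σ ≤ 1/2`, `i ≠ j`, continuous `χ` with `|χ| ≤ C_χ`,
`L, κ, ζ ≥ 0` with `2Lκ ≤ δ`, and the contact hypothesis for the pair `(i, j)` at accuracy `ζ` on the
shell of width `δ`:
`|E_{G_N}[χ(xᵢ) · tubeMark κ Ξ (ε⁻¹ sepVec xᵢ xⱼ) vᵢ vⱼ] − (∫ χ) · Y(σ³) ε³ κ Θ̄_Ξ| ≤ C_χ · ζ ε³ κ · 4L² |S²|`.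
[folklore] -/
theorem pair_tubeMark_mean_of_speedCutoff {σ a θ : ℝ} {u : V3} {N : ℕ}
    (Φ : HardSphereFlow (Torus.geometry (Fin 3)) (hsDiameter σ N) (N + 1))
    {i j : Fin (N + 1)} (hij : i ≠ j) (hσ : 0 < σ) (hσ2 : σ ≤ 1 / 2) (ha : 0 < a) (hθ : 0 < θ)
    {χ : T3 → ℝ} (hχ : Continuous χ) {Cχ : ℝ} (hCχ : ∀ y, |χ y| ≤ Cχ)
    {Ξ : V3 × V3 × V3 → ℝ} (hΞc : Continuous Ξ) {L κ δ ζ : ℝ} (hΞb : ∀ p, |Ξ p| ≤ 2 * L)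
    (hΞL : ∀ m v v' : V3, 2 * L ≤ ‖v - v'‖ → Ξ (m, v, v') = 0)
    (hL : 0 ≤ L) (hκ : 0 ≤ κ) (hζ : 0 ≤ ζ) (hLκδ : 2 * L * κ ≤ δ)
    (hC : ∀ S : Set V3, MeasurableSet S → S ⊆ {q | 1 < ‖q‖ ∧ ‖q‖ ≤ 1 + δ} →
      |(localGibbsLaw σ (fun _ => a) (fun _ => u) (fun _ => θ) N Φ).real
          {z | Torus.reprSym ((z i).1 - (z j).1) ∈ hsDiameter σ N • S}
        - contactValue (σ ^ 3) * hsDiameter σ N ^ 3 * (volume S).toReal|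
        ≤ ζ * hsDiameter σ N ^ 3 * (volume S).toReal) :
    |(∫ z, χ (z i).1 * pairTubeMark (hsDiameter σ N) κ Ξ i j
          (fun m => (z m).1) (fun m => (z m).2)
        ∂(localGibbsLaw σ (fun _ => a) (fun _ => u) (fun _ => θ) N Φ))
      - (∫ y, χ y) * (contactValue (σ ^ 3) * hsDiameter σ N ^ 3 * κ *
          ∫ p : V3 × V3, sphereMark Ξ p.1 p.2 *
            (localMaxwellian 1 θ u p.1 * localMaxwellian 1 θ u p.2))|
      ≤ Cχ * (ζ * hsDiameter σ N ^ 3 * κ *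
          (2 * L * (2 * L) * (sphereMeasure : Measure (Metric.sphere (0 : V3) 1)).real univ)) := by
  have hε : 0 < hsDiameter σ N := hsDiameter_pos hσ N
  have hΞm : Measurable Ξ := hΞc.measurable
  haveI hPprob : IsProbabilityMeasure (posGibbsMeasure (fun _ : T3 => a) (hsDiameter σ N) (N + 1)) :=
    isProbabilityMeasure_posGibbsMeasure continuous_const (fun _ => ha) hσ2 N
  have hCχ0 : 0 ≤ Cχ := (abs_nonneg _).trans (hCχ 0)
  have hχb : |∫ y, χ y| ≤ Cχ := by
    have h := norm_integral_le_of_norm_le_const (μ := (volume : Measure T3)) (f := χ) (C := Cχ)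
      (ae_of_all _ fun y => by rw [Real.norm_eq_abs]; exact hCχ y)
    simpa only [Real.norm_eq_abs, probReal_univ, mul_one] using h
  have hφb : ∀ x v, |pairTubeMark (hsDiameter σ N) κ Ξ i j x v| ≤ 2 * L :=
    abs_pairTubeMark_le _ _ hΞb i j
  -- the disintegration
  rw [integral_localGibbsLaw_mul_shiftInvariant Φ hσ2 ha hθ hχ i
    (measurable_pairTubeMark (hsDiameter σ N) κ hΞm i j) hφb
    (pairTubeMark_add_const (hsDiameter σ N) κ Ξ i j)]
  -- the contact hypothesis in configurational form
  have hCP : ∀ S : Set V3, MeasurableSet S → S ⊆ {q | 1 < ‖q‖ ∧ ‖q‖ ≤ 1 + δ} →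
      |(posGibbsMeasure (fun _ : T3 => a) (hsDiameter σ N) (N + 1)).real
          {x | Torus.reprSym (x i - x j) ∈ hsDiameter σ N • S} -
        contactValue (σ ^ 3) * hsDiameter σ N ^ 3 * (volume : Measure V3).real S| ≤
        ζ * hsDiameter σ N ^ 3 * (volume : Measure V3).real S := by
    intro S hS hSδ
    have hS' : MeasurableSet {x : Fin (N + 1) → T3 | Torus.reprSym (x i - x j) ∈ hsDiameter σ N • S} := by
      have e : {x : Fin (N + 1) → T3 | Torus.reprSym (x i - x j) ∈ hsDiameter σ N • S} =
          (fun x => (hsDiameter σ N)⁻¹ • Torus.reprSym (x i - x j)) ⁻¹' S := by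
        ext x; simp only [mem_setOf_eq, mem_preimage, mem_smul_set_iff_inv_smul_mem₀ hε.ne']
      rw [e]; exact measurable_sep (hsDiameter σ N) i j hS
    have hconv : (posGibbsMeasure (fun _ : T3 => a) (hsDiameter σ N) (N + 1)).real
        {x | Torus.reprSym (x i - x j) ∈ hsDiameter σ N • S} =
        (localGibbsLaw σ (fun _ => a) (fun _ => u) (fun _ => θ) N Φ).real
          {z | Torus.reprSym ((z i).1 - (z j).1) ∈ hsDiameter σ N • S} := by
      rw [measureReal_def, measureReal_def, ← localGibbsLaw_posEvent σ ha.le hθ u N Φ hS']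
      rfl
    rw [hconv]
    exact hC S hS hSδ
  -- the position average for fixed velocities
  have key : ∀ v : Fin (N + 1) → V3,
      |(∫ x, pairTubeMark (hsDiameter σ N) κ Ξ i j x v
          ∂posGibbsMeasure (fun _ : T3 => a) (hsDiameter σ N) (N + 1)) -
        contactValue (σ ^ 3) * hsDiameter σ N ^ 3 * κ * sphereMark Ξ (v i) (v j)| ≤
        ζ * hsDiameter σ N ^ 3 * κ *
          (2 * L * (2 * L) * (sphereMeasure : Measure (Metric.sphere (0 : V3) 1)).real univ) :=
    fun v => abs_integral_tubeMark_sub_le_of_speedCutoff (posGibbsMeasure (fun _ : T3 => a) (hsDiameter σ N) (N + 1))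
      hε i j hΞm hΞb hΞL hL hκ (by positivity : 0 ≤ ζ * hsDiameter σ N ^ 3) hLκδ hCP (v i) (v j)
  -- the velocity average
  by_cases hχ0 : ∫ y, χ y = 0
  · rw [hχ0, zero_mul, zero_mul, sub_zero, abs_zero]
    positivity
  have hΘm : Measurable fun p : V3 × V3 => sphereMark Ξ p.1 p.2 :=
    measurable_sphereMark hΞc
  have hpair : ∫ v, sphereMark Ξ (v i) (v j)
      ∂Measure.pi (fun _ : Fin (N + 1) => gaussMeasure u θ) =
      ∫ p : V3 × V3, sphereMark Ξ p.1 p.2 *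
        (localMaxwellian 1 θ u p.1 * localMaxwellian 1 θ u p.2) :=
    integral_pi_pair_gauss hθ u hij (f := fun p : V3 × V3 => sphereMark Ξ p.1 p.2) hΘm
  have hsw : StronglyMeasurable (uncurry fun (v : Fin (N + 1) → V3) (x : Fin (N + 1) → T3) =>
      pairTubeMark (hsDiameter σ N) κ Ξ i j x v) := by
    have h := ((measurable_pairTubeMark (hsDiameter σ N) κ hΞm i j).comp measurable_swap).stronglyMeasurable
    exact h
  have hIm : Measurable fun v : Fin (N + 1) → V3 =>
      ∫ x, pairTubeMark (hsDiameter σ N) κ Ξ i j x v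
        ∂posGibbsMeasure (fun _ : T3 => a) (hsDiameter σ N) (N + 1) :=
    hsw.integral_prod_right'.measurable
  have hIint : Integrable (fun v : Fin (N + 1) → V3 =>
      ∫ x, pairTubeMark (hsDiameter σ N) κ Ξ i j x v
        ∂posGibbsMeasure (fun _ : T3 => a) (hsDiameter σ N) (N + 1))
      (Measure.pi fun _ : Fin (N + 1) => gaussMeasure u θ) := by
    refine Integrable.of_bound hIm.aestronglyMeasurable (2 * L) (ae_of_all _ fun v => ?_)
    have h := norm_integral_le_of_norm_le_const
      (μ := posGibbsMeasure (fun _ : T3 => a) (hsDiameter σ N) (N + 1))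
      (f := fun x => pairTubeMark (hsDiameter σ N) κ Ξ i j x v) (C := 2 * L)
      (ae_of_all _ fun x => by rw [Real.norm_eq_abs]; exact hφb x v)
    simpa only [probReal_univ, mul_one] using h
  have hΘint : Integrable (fun v : Fin (N + 1) → V3 =>
      contactValue (σ ^ 3) * hsDiameter σ N ^ 3 * κ * sphereMark Ξ (v i) (v j))
      (Measure.pi fun _ : Fin (N + 1) => gaussMeasure u θ) := by
    have hvij : Measurable fun v : Fin (N + 1) → V3 => (v i, v j) :=
      (measurable_pi_apply i).prodMk (measurable_pi_apply j)
    have hm := (hΘm.comp hvij).const_mul (contactValue (σ ^ 3) * hsDiameter σ N ^ 3 * κ)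
    refine Integrable.of_bound hm.aestronglyMeasurable (|contactValue (σ ^ 3) * hsDiameter σ N ^ 3 * κ| *
      (2 * L * (2 * L) * (sphereMeasure : Measure (Metric.sphere (0 : V3) 1)).real univ))
      (ae_of_all _ fun v => ?_)
    · rw [Real.norm_eq_abs, abs_mul]
      exact mul_le_mul_of_nonneg_left (abs_sphereMark_le_of_speedCutoff hΞb hL hΞL _ _) (abs_nonneg _)
  have hbound : |(∫ v, ∫ x, pairTubeMark (hsDiameter σ N) κ Ξ i j x v
      ∂posGibbsMeasure (fun _ : T3 => a) (hsDiameter σ N) (N + 1)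
      ∂Measure.pi (fun _ : Fin (N + 1) => gaussMeasure u θ)) -
      contactValue (σ ^ 3) * hsDiameter σ N ^ 3 * κ *
        ∫ p : V3 × V3, sphereMark Ξ p.1 p.2 *
          (localMaxwellian 1 θ u p.1 * localMaxwellian 1 θ u p.2)| ≤
      ζ * hsDiameter σ N ^ 3 * κ *
        (2 * L * (2 * L) * (sphereMeasure : Measure (Metric.sphere (0 : V3) 1)).real univ) := by
    rw [← hpair, ← integral_const_mul, ← integral_sub hIint hΘint]
    have h := norm_integral_le_of_norm_le_const (μ := Measure.pi fun _ : Fin (N + 1) => gaussMeasure u θ)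
      (C := ζ * hsDiameter σ N ^ 3 * κ *
        (2 * L * (2 * L) * (sphereMeasure : Measure (Metric.sphere (0 : V3) 1)).real univ))
      (f := fun v : Fin (N + 1) → V3 =>
        (∫ x, pairTubeMark (hsDiameter σ N) κ Ξ i j x v
          ∂posGibbsMeasure (fun _ : T3 => a) (hsDiameter σ N) (N + 1)) -
          contactValue (σ ^ 3) * hsDiameter σ N ^ 3 * κ * sphereMark Ξ (v i) (v j))
      (ae_of_all _ fun v => by rw [Real.norm_eq_abs]; exact key v)
    simpa only [Real.norm_eq_abs, probReal_univ, mul_one] using h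
  rw [← mul_sub, abs_mul]
  exact mul_le_mul hχb hbound (abs_nonneg _) hCχ0

/-! ## A nonzero tube mark puts the pair into the near-contact shell -/

/-- **A nonzero tube mark of a mark with a speed cutoff forces the pair into the near-contact shell**:
`|tubeMark κ Ξ (ε⁻¹ sepVec xᵢ xⱼ) vᵢ vⱼ| ≤ 2L · shellInd` (`ε > 0`, `L, κ ≥ 0`: off the shell
`ε < ‖q‖ ≤ ε(1 + 2Lκ)` either the pair is not in the strict tube or its relative speed is `≥ 2L`, where
`Ξ` vanishes). [folklore] -/
theorem abs_tubeMark_le_shellInd_of_speedCutoff {σ : ℝ} {N : ℕ} (hε : 0 < hsDiameter σ N)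
    {Ξ : V3 × V3 × V3 → ℝ} {L κ : ℝ} (hΞb : ∀ p, |Ξ p| ≤ 2 * L)
    (hΞL : ∀ m v v' : V3, 2 * L ≤ ‖v - v'‖ → Ξ (m, v, v') = 0)
    (hL : 0 ≤ L) (hκ : 0 ≤ κ) (z : Config (N + 1) (Fin 3) T3) (i j : Fin (N + 1)) :
    |tubeMark κ Ξ ((hsDiameter σ N)⁻¹ • Torus.reprSym ((z i).1 - (z j).1)) (z i).2 (z j).2|
      ≤ 2 * L * shellInd σ N L κ z i j := by
  by_cases h0 : tubeMark κ Ξ ((hsDiameter σ N)⁻¹ • Torus.reprSym ((z i).1 - (z j).1))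
      (z i).2 (z j).2 = 0
  · rw [h0, abs_zero]
    exact mul_nonneg (by linarith) (shellInd_nonneg L κ z i j)
  -- the pair is in the strict tube and the relative speed is `< 2L`
  obtain ⟨h1, h2⟩ := mem_shell_of_tubeMark_ne_zero h0
  have hmem : (hsDiameter σ N)⁻¹ • Torus.reprSym ((z i).1 - (z j).1) ∈ strictTube κ ((z i).2 - (z j).2) := by
    by_contra hn
    exact h0 (by rw [tubeMark, if_neg hn])
  have hΞne : Ξ (impactNormal ((z i).2 - (z j).2)
      ((hsDiameter σ N)⁻¹ • Torus.reprSym ((z i).1 - (z j).1)), (z i).2, (z j).2) ≠ 0 := by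
    intro hz
    exact h0 (by rw [tubeMark, if_pos hmem, hz])
  have hspeed' : ‖(z i).2 - (z j).2‖ < 2 * L := by
    by_contra hn
    exact hΞne (hΞL _ _ _ (not_lt.1 hn))
  -- hence the shell indicator is `1`
  have hn : ‖(hsDiameter σ N)⁻¹ • Torus.reprSym ((z i).1 - (z j).1)‖ = (hsDiameter σ N)⁻¹ * ‖sepAt z i j‖ := by
    rw [norm_smul, Real.norm_eq_abs, abs_of_pos (inv_pos.2 hε)]
    rfl
  rw [hn] at h1 h2
  have hs1 : hsDiameter σ N < ‖sepAt z i j‖ := by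
    rwa [lt_inv_mul_iff₀ hε, mul_one] at h1
  have hs2 : ‖sepAt z i j‖ ≤ hsDiameter σ N * (1 + 2 * L * κ) := by
    have h3 : (hsDiameter σ N)⁻¹ * ‖sepAt z i j‖ ≤ 1 + 2 * L * κ := by
      refine h2.trans ?_
      have := mul_le_mul_of_nonneg_left hspeed'.le hκ
      linarith
    rwa [inv_mul_le_iff₀ hε] at h3
  rw [shellInd, if_pos ⟨hs1, hs2⟩, mul_one]
  exact abs_tubeMark_le hΞb _ _ _

/-- **At most `125` nonzero tube marks per particle, each of size `≤ 2L`**: on the hard-sphere domain and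
for `2Lκ ≤ 1`, `Σⱼ |tubeMark κ Ξ (ε⁻¹ sepVec xᵢ xⱼ) vᵢ vⱼ| ≤ 2L · 125` (`shellCount_le`). [folklore] -/
theorem sum_abs_tubeMark_le_of_speedCutoff {σ : ℝ} {N : ℕ} (hε : 0 < hsDiameter σ N)
    {Ξ : V3 × V3 × V3 → ℝ} {L κ : ℝ} (hΞb : ∀ p, |Ξ p| ≤ 2 * L)
    (hΞL : ∀ m v v' : V3, 2 * L ≤ ‖v - v'‖ → Ξ (m, v, v') = 0)
    (hL : 0 ≤ L) (hκ : 0 ≤ κ) (hLκ : 2 * L * κ ≤ 1) {z : Config (N + 1) (Fin 3) T3}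
    (hz : z ∈ hardSphereDomain (Torus.geometry (Fin 3)) (N + 1) (hsDiameter σ N)) (i : Fin (N + 1)) :
    ∑ j, |tubeMark κ Ξ ((hsDiameter σ N)⁻¹ • Torus.reprSym ((z i).1 - (z j).1))
      (z i).2 (z j).2| ≤ 2 * L * 125 := by
  calc ∑ j, |tubeMark κ Ξ ((hsDiameter σ N)⁻¹ • Torus.reprSym ((z i).1 - (z j).1))
        (z i).2 (z j).2|
      ≤ ∑ j, 2 * L * shellInd σ N L κ z i j :=
        Finset.sum_le_sum fun j _ => abs_tubeMark_le_shellInd_of_speedCutoff hε hΞb hΞL hL hκ z i j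
    _ = 2 * L * shellCount σ N L κ z i := by rw [shellCount, Finset.mul_sum]
    _ ≤ 2 * L * 125 := mul_le_mul_of_nonneg_left (shellCount_le hε hLκ hz i) (by linarith)

/-! ## The density-weight replacement in rung-0 Gibbs mean -/

/-- **Replacing the density weight `g(σ³ρ̃_r(x, xᵢ))` by `g(σ³)` in the tube functional costs little in
rung-0 Gibbs mean.**  For constant profiles `a, θ > 0`, `u`, `0 < σ ≤ 1/2`, `|χ| ≤ C_χ`, `|g| ≤ C_g` on
`[0, ∞)` with `|g(s y) − g(s)| ≤ ζ'` whenever `y ≥ 0`, `|y − 1| < δ` (`s ≥ 0`), `L, κ ≥ 0`, `2Lκ ≤ 1`,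
`r > 0`:
`E_{G_N}[Σ_{i≠j} |χ(xᵢ)| |g(s ρ̃_r(x,xᵢ)) − g(s)| |tubeMark_{ij}|] ≤ 2L · 125 · (N+1) · C_χ · (ζ' + 2C_g P_N(Bad_N(δ, r)))`
(packing on the hard-sphere domain, which holds almost surely; then the position marginal). [folklore] -/
theorem integral_sum_densityWeight_tubeMark_le_of_speedCutoff {σ a θ : ℝ} {u : V3} {N : ℕ}
    (Φ : HardSphereFlow (Torus.geometry (Fin 3)) (hsDiameter σ N) (N + 1))
    (hσ : 0 < σ) (hσ2 : σ ≤ 1 / 2) (ha : 0 < a) (hθ : 0 < θ)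
    {χ : T3 → ℝ} (hχ : Continuous χ) {Cχ : ℝ} (hCχ : ∀ y, |χ y| ≤ Cχ)
    {g : ℝ → ℝ} (hg : Continuous g) {Cg : ℝ} (hCg : ∀ y, 0 ≤ y → |g y| ≤ Cg) {s : ℝ} (hs : 0 ≤ s)
    {ζ' δ : ℝ} (hζ' : 0 ≤ ζ') (hδ : 0 < δ) (hmod : ∀ y, 0 ≤ y → |y - 1| < δ → |g (s * y) - g s| ≤ ζ')
    {Ξ : V3 × V3 × V3 → ℝ} {L κ r : ℝ} (hΞb : ∀ p, |Ξ p| ≤ 2 * L)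
    (hΞL : ∀ m v v' : V3, 2 * L ≤ ‖v - v'‖ → Ξ (m, v, v') = 0)
    (hL : 0 ≤ L) (hκ : 0 ≤ κ) (hLκ : 2 * L * κ ≤ 1) (hr : 0 < r) :
    ∫ z, (∑ i, ∑ j, if i ≠ j then |χ (z i).1| * |g (s * empDensity r (fun m => (z m).1) (z i).1) - g s| *
        |tubeMark κ Ξ ((hsDiameter σ N)⁻¹ • Torus.reprSym ((z i).1 - (z j).1))
          (z i).2 (z j).2| else 0) ∂(localGibbsLaw σ (fun _ => a) (fun _ => u) (fun _ => θ) N Φ) ≤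
      2 * L * 125 * (N + 1 : ℝ) * Cχ * (ζ' + 2 * Cg *
        (posGibbsMeasure (fun _ : T3 => a) (hsDiameter σ N) (N + 1)).real (sqDevEvent (N + 1) δ r)) := by
  have hε : 0 < hsDiameter σ N := hsDiameter_pos hσ N
  have hCχ0 : 0 ≤ Cχ := (abs_nonneg _).trans (hCχ 0)
  have hCg0 : 0 ≤ Cg := (abs_nonneg _).trans (hCg 0 le_rfl)
  set G := localGibbsLaw σ (fun _ => a) (fun _ => u) (fun _ => θ) N Φ with hGdef
  set P := posGibbsMeasure (fun _ : T3 => a) (hsDiameter σ N) (N + 1) with hPdef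
  haveI hPprob : IsProbabilityMeasure P := isProbabilityMeasure_posGibbsMeasure continuous_const (fun _ => ha) hσ2 N
  haveI hGprob : IsProbabilityMeasure G := isProbabilityMeasure_localGibbsLaw continuous_const continuous_const
    continuous_const (fun _ => ha) (fun _ => hθ) hσ2 N Φ
  -- the deviation weight of particle `i`, a function of the positions
  set D : (Fin (N + 1) → T3) → Fin (N + 1) → ℝ :=
    fun x i => |g (s * empDensity r x (x i)) - g s| with hD
  have hD0 : ∀ x i, 0 ≤ D x i := fun x i => abs_nonneg _
  have hDb : ∀ x i, D x i ≤ 2 * Cg := fun x i => by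
    have hy : 0 ≤ empDensity r x (x i) := (empDensity_mem_Icc hr x (x i)).1
    calc D x i ≤ |g (s * empDensity r x (x i))| + |g s| := abs_sub _ _
      _ ≤ Cg + Cg := add_le_add (hCg _ (mul_nonneg hs hy)) (hCg _ hs)
      _ = 2 * Cg := by ring
  have hDm : ∀ i, Measurable fun x => D x i := fun i => by
    -- compositions are elaborated without expected type (else the unifier unfolds `empDensity`)
    have h0 : Measurable fun x : Fin (N + 1) → T3 => (x, x i) := measurable_id.prodMk (measurable_pi_apply i)
    have h1 := (measurable_empDensity r).comp h0
    have h2 := ((hg.measurable.comp (h1.const_mul s)).sub (measurable_const (a := g s))).abs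
    exact h2
  -- the position weight `W(x) = Σᵢ |χ(xᵢ)| Dᵢ(x)`
  set W : (Fin (N + 1) → T3) → ℝ := fun x => ∑ i, |χ (x i)| * D x i with hW
  have hWm : Measurable W := Finset.measurable_sum _ fun i _ =>
    ((hχ.measurable.comp (measurable_pi_apply i)).abs).mul (hDm i)
  have hW0 : ∀ x, 0 ≤ W x := fun x => Finset.sum_nonneg fun i _ => mul_nonneg (abs_nonneg _) (hD0 x i)
  have hWb : ∀ x, W x ≤ (N + 1 : ℝ) * (Cχ * (2 * Cg)) := fun x => by
    calc W x ≤ ∑ _i : Fin (N + 1), Cχ * (2 * Cg) :=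
          Finset.sum_le_sum fun i _ => mul_le_mul (hCχ _) (hDb x i) (hD0 x i) hCχ0
      _ = (N + 1 : ℝ) * (Cχ * (2 * Cg)) := by
          rw [Finset.sum_const, Finset.card_univ, Fintype.card_fin, nsmul_eq_mul]; push_cast; ring
  -- pointwise bound on the hard-sphere domain
  have hpt : ∀ z ∈ hardSphereDomain (Torus.geometry (Fin 3)) (N + 1) (hsDiameter σ N),
      (∑ i, ∑ j, if i ≠ j then |χ (z i).1| * |g (s * empDensity r (fun m => (z m).1) (z i).1) - g s| *
        |tubeMark κ Ξ ((hsDiameter σ N)⁻¹ • Torus.reprSym ((z i).1 - (z j).1))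
          (z i).2 (z j).2| else 0) ≤ 2 * L * 125 * W (fun m => (z m).1) := by
    intro z hz
    rw [hW]
    dsimp only
    rw [Finset.mul_sum]
    refine Finset.sum_le_sum fun i _ => ?_
    calc (∑ j, if i ≠ j then |χ (z i).1| * |g (s * empDensity r (fun m => (z m).1) (z i).1) - g s| *
          |tubeMark κ Ξ ((hsDiameter σ N)⁻¹ • Torus.reprSym ((z i).1 - (z j).1))
            (z i).2 (z j).2| else 0)
        ≤ ∑ j, |χ (z i).1| * |g (s * empDensity r (fun m => (z m).1) (z i).1) - g s| *
          |tubeMark κ Ξ ((hsDiameter σ N)⁻¹ • Torus.reprSym ((z i).1 - (z j).1))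
            (z i).2 (z j).2| := by
          refine Finset.sum_le_sum fun j _ => ?_
          split_ifs
          · exact le_rfl
          · positivity
      _ = |χ (z i).1| * D (fun m => (z m).1) i *
          ∑ j, |tubeMark κ Ξ ((hsDiameter σ N)⁻¹ • Torus.reprSym ((z i).1 - (z j).1))
            (z i).2 (z j).2| := by rw [Finset.mul_sum]
      _ ≤ |χ (z i).1| * D (fun m => (z m).1) i * (2 * L * 125) :=
          mul_le_mul_of_nonneg_left (sum_abs_tubeMark_le_of_speedCutoff hε hΞb hΞL hL hκ hLκ hz i)
            (mul_nonneg (abs_nonneg _) (hD0 _ _))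
      _ = 2 * L * 125 * (|χ (z i).1| * D (fun m => (z m).1) i) := by ring
  -- integrate: the hard core holds almost surely, then the position marginal
  have hint_rhs : Integrable (fun z : Config (N + 1) (Fin 3) T3 => 2 * L * 125 * W (fun m => (z m).1)) G := by
    have hm : Measurable fun z : Config (N + 1) (Fin 3) T3 => W (fun m => (z m).1) :=
      hWm.comp (measurable_pi_lambda _ fun m => (measurable_pi_apply m).fst)
    refine Integrable.of_bound (hm.const_mul _).aestronglyMeasurable (|2 * L * 125| * ((N + 1 : ℝ) * (Cχ * (2 * Cg))))
      (ae_of_all _ fun z => ?_)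
    rw [Real.norm_eq_abs, abs_mul, abs_of_nonneg (hW0 _)]
    exact mul_le_mul_of_nonneg_left (hWb _) (abs_nonneg _)
  have hstep1 : ∫ z, (∑ i, ∑ j, if i ≠ j then |χ (z i).1| * |g (s * empDensity r (fun m => (z m).1) (z i).1) - g s| *
        |tubeMark κ Ξ ((hsDiameter σ N)⁻¹ • Torus.reprSym ((z i).1 - (z j).1))
          (z i).2 (z j).2| else 0) ∂G ≤ ∫ z, 2 * L * 125 * W (fun m => (z m).1) ∂G := by
    refine integral_mono_of_nonneg (ae_of_all _ fun z => ?_) hint_rhs ?_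
    · exact Finset.sum_nonneg fun i _ => Finset.sum_nonneg fun j _ => by
        split_ifs
        · positivity
        · exact le_rfl
    · filter_upwards [ae_mem_hardSphereDomain σ (fun _ => a) (fun _ => u) (fun _ => θ) N Φ] with z hz
      exact hpt z hz
  have hstep2 : ∫ z, 2 * L * 125 * W (fun m => (z m).1) ∂G = 2 * L * 125 * ∫ x, W x ∂P := by
    rw [integral_const_mul, hGdef, integral_localGibbsLaw_rung0 σ ha.le hθ u N Φ]
    congr 1
    have e : (fun p : (Fin (N + 1) → T3) × (Fin (N + 1) → V3) => W fun m => (zipConfig p m).1) = fun p => W p.1 := by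
      funext p
      simp only [zipConfig_apply]
    rw [e, integral_fun_fst, probReal_univ, one_smul]
  -- the position average of `W`
  have hstep3 : ∫ x, W x ∂P ≤ (N + 1 : ℝ) * Cχ * (ζ' + 2 * Cg * P.real (sqDevEvent (N + 1) δ r)) := by
    have hBm : MeasurableSet (sqDevEvent (N + 1) δ r) := measurableSet_sqDevEvent (N + 1) δ r
    -- `Dᵢ ≤ ζ' + 2 C_g 𝟙[Bad]`
    have hDle : ∀ x i, D x i ≤ ζ' + (sqDevEvent (N + 1) δ r).indicator (fun _ => 2 * Cg) x := by
      intro x i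
      by_cases hx : x ∈ sqDevEvent (N + 1) δ r
      · rw [indicator_of_mem hx]
        linarith [hDb x i]
      · rw [indicator_of_notMem hx, add_zero]
        exact hmod _ (empDensity_mem_Icc hr x (x i)).1 (abs_empDensity_sub_one_lt_of_not_mem hδ hr hx (x i))
    have hbound : ∀ x, W x ≤ (N + 1 : ℝ) * Cχ * (ζ' + (sqDevEvent (N + 1) δ r).indicator (fun _ => 2 * Cg) x) := by
      intro x
      have hind0 : 0 ≤ (sqDevEvent (N + 1) δ r).indicator (fun _ => 2 * Cg) x :=
        Set.indicator_nonneg (fun _ _ => by positivity) x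
      calc W x ≤ ∑ _i : Fin (N + 1), Cχ * (ζ' + (sqDevEvent (N + 1) δ r).indicator (fun _ => 2 * Cg) x) :=
            Finset.sum_le_sum fun i _ => mul_le_mul (hCχ _) (hDle x i) (hD0 x i) hCχ0
        _ = (N + 1 : ℝ) * Cχ * (ζ' + (sqDevEvent (N + 1) δ r).indicator (fun _ => 2 * Cg) x) := by
            rw [Finset.sum_const, Finset.card_univ, Fintype.card_fin, nsmul_eq_mul]; push_cast; ring
    have hint_b : Integrable (fun x => (N + 1 : ℝ) * Cχ * (ζ' + (sqDevEvent (N + 1) δ r).indicator (fun _ => 2 * Cg) x)) P :=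
      ((integrable_const ζ').add ((integrable_const (2 * Cg)).indicator hBm)).const_mul _
    calc ∫ x, W x ∂P ≤ ∫ x, (N + 1 : ℝ) * Cχ * (ζ' + (sqDevEvent (N + 1) δ r).indicator (fun _ => 2 * Cg) x) ∂P :=
          integral_mono_of_nonneg (ae_of_all _ hW0) hint_b (ae_of_all _ hbound)
      _ = (N + 1 : ℝ) * Cχ * (ζ' + 2 * Cg * P.real (sqDevEvent (N + 1) δ r)) := by
          rw [integral_const_mul, integral_add (integrable_const ζ') ((integrable_const (2 * Cg)).indicator hBm),
            integral_const, probReal_univ, one_smul, integral_indicator hBm, setIntegral_const, smul_eq_mul,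
            mul_comm (P.real _) (2 * Cg)]
  calc _ ≤ ∫ z, 2 * L * 125 * W (fun m => (z m).1) ∂G := hstep1
    _ = 2 * L * 125 * ∫ x, W x ∂P := hstep2
    _ ≤ 2 * L * 125 * ((N + 1 : ℝ) * Cχ * (ζ' + 2 * Cg * P.real (sqDevEvent (N + 1) δ r))) :=
        mul_le_mul_of_nonneg_left hstep3 (by positivity)
    _ = 2 * L * 125 * (N + 1 : ℝ) * Cχ * (ζ' + 2 * Cg * P.real (sqDevEvent (N + 1) δ r)) := by ring

/-! ## The fixed-time tube mean at rung 0 under the contact hypothesis -/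

/-- **The fixed-time collision-tube functional has the Enskog mean at rung 0, conditionally on the
contact hypothesis, for every continuous mark `Ξ` with `|Ξ| ≤ 2L` vanishing at relative speed `≥ 2L`** (no
vanishing at grazing normals: grazing pairs are negligible).  Constant profiles `a, θ > 0`, `u`, small reduced
density `σ`, `N ≥ 1`; continuous `χ` with
`|χ(t, ·)| ≤ C_χ`; continuous `g` with `|g| ≤ C_g` on `[0, ∞)` and `|g(σ³ y) − g(σ³)| ≤ ζ'` for `y ≥ 0`,
`|y − 1| < δ''`; `L ≥ 0`, `κ > 0`, `2Lκ ≤ min δ 1`, `0 < r`; and the contact hypothesis for every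
ordered pair at accuracy `ζ ≥ 0` on the shell of width `δ`.  Then
`|E_{G_N} A_t − σ³ g(σ³) Y Θ̄_Ξ ∫χ(t,·)| ≤ σ³ C_g C_χ 4L²|S²| ζ + κ⁻¹ 2L·125 C_χ (ζ' + 2C_g P_N(Bad)) + σ³/(N+1) · C_g C_χ |Y| |Θ̄_Ξ|`.
[folklore] -/
theorem abs_integral_tubeStat_sub_le_of_speedCutoff {σ a θ : ℝ} {u : V3} {N : ℕ}
    (Φ : HardSphereFlow (Torus.geometry (Fin 3)) (hsDiameter σ N) (N + 1))
    (hsd : SmallDensity uniformProfile σ) (hN : 1 ≤ N) (ha : 0 < a) (hθ : 0 < θ)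
    {χ : ℝ × UnitAddTorus (Fin 3) → ℝ} (hχ : Continuous χ) {t Cχ : ℝ} (hCχ : ∀ y, |χ (t, y)| ≤ Cχ)
    {g : ℝ → ℝ} (hg : Continuous g) {Cg : ℝ} (hCg : ∀ y, 0 ≤ y → |g y| ≤ Cg)
    {Ξ : V3 × V3 × V3 → ℝ} (hΞc : Continuous Ξ) {L κ δ ζ ζ' δ'' r : ℝ} (hΞb : ∀ p, |Ξ p| ≤ 2 * L)
    (hΞL : ∀ m v v' : V3, 2 * L ≤ ‖v - v'‖ → Ξ (m, v, v') = 0)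
    (hL : 0 ≤ L) (hκ : 0 < κ) (hζ : 0 ≤ ζ) (hζ' : 0 ≤ ζ')
    (hδ'' : 0 < δ'') (hLκδ : 2 * L * κ ≤ δ) (hLκ : 2 * L * κ ≤ 1) (hr : 0 < r)
    (hmod : ∀ y, 0 ≤ y → |y - 1| < δ'' → |g (σ ^ 3 * y) - g (σ ^ 3)| ≤ ζ')
    (hC : ∀ i j : Fin (N + 1), i ≠ j → ∀ S : Set V3, MeasurableSet S → S ⊆ {q | 1 < ‖q‖ ∧ ‖q‖ ≤ 1 + δ} →
      |(localGibbsLaw σ (fun _ => a) (fun _ => u) (fun _ => θ) N Φ).real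
          {z | Torus.reprSym ((z i).1 - (z j).1) ∈ hsDiameter σ N • S}
        - contactValue (σ ^ 3) * hsDiameter σ N ^ 3 * (volume S).toReal|
        ≤ ζ * hsDiameter σ N ^ 3 * (volume S).toReal) :
    |(∫ z, tubeStat σ N χ g Ξ r r 1 κ t z
        ∂(localGibbsLaw σ (fun _ => a) (fun _ => u) (fun _ => θ) N Φ)) -
      σ ^ 3 * g (σ ^ 3) * contactValue (σ ^ 3) *
        (∫ p : V3 × V3, sphereMark Ξ p.1 p.2 *
          (localMaxwellian 1 θ u p.1 * localMaxwellian 1 θ u p.2)) * ∫ x : UnitAddTorus (Fin 3), χ (t, x)|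
      ≤ σ ^ 3 * Cg * Cχ * (2 * L * (2 * L) * (sphereMeasure : Measure (Metric.sphere (0 : V3) 1)).real univ) * ζ
        + κ⁻¹ * (2 * L * 125) * Cχ * (ζ' + 2 * Cg *
          (posGibbsMeasure (fun _ : T3 => a) (hsDiameter σ N) (N + 1)).real (sqDevEvent (N + 1) δ'' r))
        + σ ^ 3 / (N + 1 : ℝ) * Cg * Cχ * |contactValue (σ ^ 3)| *
          |∫ p : V3 × V3, sphereMark Ξ p.1 p.2 *
            (localMaxwellian 1 θ u p.1 * localMaxwellian 1 θ u p.2)| := by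
  -- abbreviations (plain `have`-equations; the diameter is kept verbatim)
  have hσ : 0 < σ := hsd.σ_pos
  have hσ2 : σ ≤ 1 / 2 := hsd.σ_lt_half.le
  have hε : 0 < hsDiameter σ N := hsDiameter_pos hσ N
  have hnε : ((N + 1 : ℕ) : ℝ) * hsDiameter σ N ^ 3 = σ ^ 3 := succ_mul_hsDiameter_pow_three σ N
  have hn0 : (0 : ℝ) < (N + 1 : ℕ) := by exact_mod_cast Nat.succ_pos N
  have hCχ0 : 0 ≤ Cχ := (abs_nonneg _).trans (hCχ (0 : UnitAddTorus (Fin 3)))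
  have hCg0 : 0 ≤ Cg := (abs_nonneg _).trans (hCg 0 le_rfl)
  have hgσ : |g (σ ^ 3)| ≤ Cg := hCg _ (by positivity)
  have hΞm : Measurable Ξ := hΞc.measurable
  haveI hGprob : IsProbabilityMeasure (localGibbsLaw σ (fun _ => a) (fun _ => u) (fun _ => θ) N Φ) :=
    isProbabilityMeasure_localGibbsLaw continuous_const continuous_const continuous_const
      (fun _ => ha) (fun _ => hθ) hσ2 N Φ
  have hχt : Continuous fun x : UnitAddTorus (Fin 3) => χ (t, x) := hχ.comp (Continuous.prodMk_right t)
  have hχb : |∫ x : UnitAddTorus (Fin 3), χ (t, x)| ≤ Cχ := by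
    have h := norm_integral_le_of_norm_le_const (μ := (volume : Measure (UnitAddTorus (Fin 3))))
      (f := fun x => χ (t, x)) (C := Cχ) (ae_of_all _ fun y => by rw [Real.norm_eq_abs]; exact hCχ y)
    simpa only [Real.norm_eq_abs, probReal_univ, mul_one] using h
  set G := localGibbsLaw σ (fun _ => a) (fun _ => u) (fun _ => θ) N Φ with hGdef
  set P := posGibbsMeasure (fun _ : T3 => a) (hsDiameter σ N) (N + 1) with hPdef
  set Y := contactValue (σ ^ 3) with hYdef
  set σS := (sphereMeasure : Measure (Metric.sphere (0 : V3) 1)).real univ with hσS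
  have hσS0 : 0 ≤ σS := measureReal_nonneg
  set Θb := ∫ p : V3 × V3, sphereMark Ξ p.1 p.2 *
    (localMaxwellian 1 θ u p.1 * localMaxwellian 1 θ u p.2) with hΘb
  set Iχ := ∫ x : UnitAddTorus (Fin 3), χ (t, x) with hIχ
  -- the pair tube mark read on a configuration, and the two summand families
  set TM : Fin (N + 1) → Fin (N + 1) → Config (N + 1) (Fin 3) T3 → ℝ := fun i j z =>
    pairTubeMark (hsDiameter σ N) κ Ξ i j (fun m => (z m).1) (fun m => (z m).2) with hTMdef
  have hTMb : ∀ i j z, |TM i j z| ≤ 2 * L := fun i j z => abs_pairTubeMark_le _ _ hΞb i j _ _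
  have hTMm : ∀ i j, Measurable (TM i j) := fun i j => measurable_pairTubeMark_config (hsDiameter σ N) κ hΞm i j
  set S1 : Fin (N + 1) → Fin (N + 1) → Config (N + 1) (Fin 3) T3 → ℝ := fun i j z =>
    if i ≠ j then χ (t, (z i).1) * g (σ ^ 3) * TM i j z else 0 with hS1def
  set S2 : Fin (N + 1) → Fin (N + 1) → Config (N + 1) (Fin 3) T3 → ℝ := fun i j z =>
    if i ≠ j then χ (t, (z i).1) * (g (σ ^ 3 * empDensity r (fun m => (z m).1) (z i).1) - g (σ ^ 3)) * TM i j z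
    else 0 with hS2def
  -- Step 0: the double-sum form of the tube functional (almost surely: no grazing pairs)
  have hA : ∀ᵐ z ∂G, tubeStat σ N χ g Ξ r r 1 κ t z =
      ((N + 1 : ℝ) * κ)⁻¹ * ((∑ i, ∑ j, S1 i j z) + ∑ i, ∑ j, S2 i j z) := by
    filter_upwards [tubeStat_one_ae_eq_sum_tubeMark Φ hsd hN ha hθ χ g Ξ r r κ] with z hz
    rw [hz t, ← Finset.sum_add_distrib]
    congr 1
    refine Finset.sum_congr rfl fun i _ => ?_
    rw [← Finset.sum_add_distrib]
    refine Finset.sum_congr rfl fun j _ => ?_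
    simp only [hS1def, hS2def, hTMdef, pairTubeMark]
    split_ifs
    · ring
    · simp
  -- measurability and bounds of the summands
  have hχim : ∀ i : Fin (N + 1), Measurable fun z : Config (N + 1) (Fin 3) T3 => χ (t, (z i).1) := fun i => by
    have h0 : Measurable fun z : Config (N + 1) (Fin 3) T3 => (z i).1 := (measurable_pi_apply i).fst
    have h := hχt.measurable.comp h0
    exact h
  have hgm : ∀ i : Fin (N + 1), Measurable fun z : Config (N + 1) (Fin 3) T3 =>
      g (σ ^ 3 * empDensity r (fun m => (z m).1) (z i).1) - g (σ ^ 3) := fun i => by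
    have h := (hg.measurable.comp ((measurable_empDensity_at r i).const_mul (σ ^ 3))).sub
      (measurable_const (a := g (σ ^ 3)))
    exact h
  have hgb : ∀ (i : Fin (N + 1)) (z : Config (N + 1) (Fin 3) T3),
      |g (σ ^ 3 * empDensity r (fun m => (z m).1) (z i).1) - g (σ ^ 3)| ≤ 2 * Cg := fun i z => by
    have hy : 0 ≤ empDensity r (fun m => (z m).1) (z i).1 := (empDensity_mem_Icc hr _ _).1
    calc _ ≤ |g (σ ^ 3 * empDensity r (fun m => (z m).1) (z i).1)| + |g (σ ^ 3)| := abs_sub _ _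
      _ ≤ Cg + Cg := add_le_add (hCg _ (by positivity)) hgσ
      _ = 2 * Cg := by ring
  have hS1m : ∀ i j, Measurable (S1 i j) := fun i j => by
    refine Measurable.ite (MeasurableSet.const _) (((hχim i).mul_const _).mul (hTMm i j)) measurable_const
  have hS2m : ∀ i j, Measurable (S2 i j) := fun i j =>
    Measurable.ite (MeasurableSet.const _) (((hχim i).mul (hgm i)).mul (hTMm i j)) measurable_const
  have hS1b : ∀ i j z, |S1 i j z| ≤ Cχ * Cg * (2 * L) := fun i j z => by
    simp only [hS1def]
    split_ifs
    · rw [abs_mul, abs_mul]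
      exact mul_le_mul (mul_le_mul (hCχ _) hgσ (abs_nonneg _) hCχ0) (hTMb i j z) (abs_nonneg _) (by positivity)
    · rw [abs_zero]; positivity
  have hS2b : ∀ i j z, |S2 i j z| ≤ Cχ * (2 * Cg) * (2 * L) := fun i j z => by
    simp only [hS2def]
    split_ifs
    · rw [abs_mul, abs_mul]
      exact mul_le_mul (mul_le_mul (hCχ _) (hgb i z) (abs_nonneg _) hCχ0) (hTMb i j z) (abs_nonneg _) (by positivity)
    · rw [abs_zero]; positivity
  have hS1i : ∀ i j, Integrable (S1 i j) G := fun i j =>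
    Integrable.of_bound (hS1m i j).aestronglyMeasurable _ (ae_of_all _ fun z => by rw [Real.norm_eq_abs]; exact hS1b i j z)
  have hS2i : ∀ i j, Integrable (S2 i j) G := fun i j =>
    Integrable.of_bound (hS2m i j).aestronglyMeasurable _ (ae_of_all _ fun z => by rw [Real.norm_eq_abs]; exact hS2b i j z)
  -- Step 1: linearity
  have hI : ∫ z, tubeStat σ N χ g Ξ r r 1 κ t z ∂G =
      ((N + 1 : ℝ) * κ)⁻¹ * ((∑ i, ∑ j, ∫ z, S1 i j z ∂G) + ∫ z, ∑ i, ∑ j, S2 i j z ∂G) := by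
    rw [integral_congr_ae hA, integral_const_mul, integral_add (integrable_finsetSum _ fun i _ => integrable_finsetSum _ fun j _ => hS1i i j)
      (integrable_finsetSum _ fun i _ => integrable_finsetSum _ fun j _ => hS2i i j),
      integral_finsetSum _ fun i _ => integrable_finsetSum _ fun j _ => hS1i i j]
    congr 2
    exact Finset.sum_congr rfl fun i _ => integral_finsetSum _ fun j _ => hS1i i j
  -- Step 2: the main part, pair by pair
  set e₁ : ℝ := Cg * (Cχ * (ζ * hsDiameter σ N ^ 3 * κ * (2 * L * (2 * L) * σS))) with he₁
  have he₁0 : 0 ≤ e₁ := by positivity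
  have hpair : ∀ i j : Fin (N + 1), |(∫ z, S1 i j z ∂G) -
      (if i ≠ j then g (σ ^ 3) * (Iχ * (Y * hsDiameter σ N ^ 3 * κ * Θb)) else 0)| ≤
      if i ≠ j then e₁ else 0 := by
    intro i j
    by_cases hij : i ≠ j
    · rw [if_pos hij, if_pos hij]
      have hm := pair_tubeMark_mean_of_speedCutoff Φ hij hσ hσ2 ha hθ hχt hCχ hΞc hΞb hΞL hL hκ.le hζ hLκδ (hC i j hij)
      have hS1 : ∫ z, S1 i j z ∂G = g (σ ^ 3) * ∫ z, χ (t, (z i).1) * TM i j z ∂G := by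
        rw [← integral_const_mul]
        refine integral_congr_ae (ae_of_all _ fun z => ?_)
        simp only [hS1def, if_pos hij]
        ring
      rw [hS1, ← mul_sub, abs_mul, he₁]
      exact mul_le_mul hgσ hm (abs_nonneg _) hCg0
    · rw [if_neg hij, if_neg hij, sub_zero]
      have h0 : ∫ z, S1 i j z ∂G = 0 := by
        simp only [hS1def, if_neg hij, integral_zero]
      rw [h0, abs_zero]
  have hmain : |(∑ i, ∑ j, ∫ z, S1 i j z ∂G) -
      ((N + 1 : ℕ) : ℝ) * N * (g (σ ^ 3) * (Iχ * (Y * hsDiameter σ N ^ 3 * κ * Θb)))| ≤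
      ((N + 1 : ℕ) : ℝ) * N * e₁ := by
    rw [← sum_sum_ite_ne_const N (g (σ ^ 3) * (Iχ * (Y * hsDiameter σ N ^ 3 * κ * Θb))), ← sum_sum_ite_ne_const N e₁]
    exact (abs_sum_sum_sub_le _ _).trans (Finset.sum_le_sum fun i _ => Finset.sum_le_sum fun j _ => hpair i j)
  -- Step 3: the density-weight error
  have herr : |∫ z, ∑ i, ∑ j, S2 i j z ∂G| ≤ 2 * L * 125 * (N + 1 : ℝ) * Cχ * (ζ' + 2 * Cg *
      P.real (sqDevEvent (N + 1) δ'' r)) := by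
    have hD := integral_sum_densityWeight_tubeMark_le_of_speedCutoff (u := u) Φ hσ hσ2 ha hθ hχt hCχ hg hCg
      (by positivity : (0 : ℝ) ≤ σ ^ 3) hζ' hδ'' hmod hΞb hΞL hL hκ.le hLκ hr
    refine le_trans ?_ hD
    rw [← Real.norm_eq_abs]
    refine norm_integral_le_of_norm_le ?_ (ae_of_all _ fun z => ?_)
    · -- integrability of the dominating function (bounded, measurable)
      have hm : Measurable fun z : Config (N + 1) (Fin 3) T3 => ∑ i, ∑ j,
          if i ≠ j then |χ (t, (z i).1)| * |g (σ ^ 3 * empDensity r (fun m => (z m).1) (z i).1) - g (σ ^ 3)| *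
            |tubeMark κ Ξ ((hsDiameter σ N)⁻¹ • Torus.reprSym ((z i).1 - (z j).1))
              (z i).2 (z j).2| else 0 := by
        refine Finset.measurable_sum _ fun i _ => Finset.measurable_sum _ fun j _ => ?_
        refine Measurable.ite (MeasurableSet.const _) ?_ measurable_const
        exact ((hχim i).abs.mul (hgm i).abs).mul (hTMm i j).abs
      refine Integrable.of_bound hm.aestronglyMeasurable (((N + 1 : ℕ) : ℝ) * (((N + 1 : ℕ) : ℝ) *
        (Cχ * (2 * Cg) * (2 * L)))) (ae_of_all _ fun z => ?_)
      rw [Real.norm_eq_abs, abs_of_nonneg (Finset.sum_nonneg fun i _ => Finset.sum_nonneg fun j _ => by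
        split_ifs
        · positivity
        · exact le_rfl)]
      calc _ ≤ ∑ _i : Fin (N + 1), ∑ _j : Fin (N + 1), Cχ * (2 * Cg) * (2 * L) := by
            refine Finset.sum_le_sum fun i _ => Finset.sum_le_sum fun j _ => ?_
            split_ifs
            · exact mul_le_mul (mul_le_mul (hCχ _) (hgb i z) (abs_nonneg _) hCχ0) (hTMb i j z) (abs_nonneg _)
                (by positivity)
            · positivity
        _ = _ := by simp only [Finset.sum_const, Finset.card_univ, Fintype.card_fin, nsmul_eq_mul]
    · rw [Real.norm_eq_abs]
      refine (Finset.abs_sum_le_sum_abs _ _).trans (Finset.sum_le_sum fun i _ => ?_)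
      refine (Finset.abs_sum_le_sum_abs _ _).trans (Finset.sum_le_sum fun j _ => ?_)
      simp only [hS2def]
      split_ifs
      · rw [abs_mul, abs_mul]
        exact le_of_eq rfl
      · rw [abs_zero]
  -- Step 4: algebra
  have hNε : (N : ℝ) * hsDiameter σ N ^ 3 ≤ σ ^ 3 := by
    have h3 : 0 ≤ hsDiameter σ N ^ 3 := by positivity
    calc (N : ℝ) * hsDiameter σ N ^ 3 ≤ ((N + 1 : ℕ) : ℝ) * hsDiameter σ N ^ 3 :=
          mul_le_mul_of_nonneg_right (by push_cast; linarith) h3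
      _ = σ ^ 3 := hnε
  have hε3 : hsDiameter σ N ^ 3 = σ ^ 3 / (N + 1 : ℝ) := by
    rw [eq_div_iff (by positivity), mul_comm]
    exact_mod_cast hnε
  have hnκ : 0 < (N + 1 : ℝ) * κ := by positivity
  -- the three error terms after the prefactor `((N+1)κ)⁻¹`
  have hn1 : (0 : ℝ) < (N : ℝ) + 1 := by positivity
  have hcancel : ((N : ℝ) + 1)⁻¹ * ((N : ℝ) + 1) = 1 := inv_mul_cancel₀ hn1.ne'
  have hκc : κ⁻¹ * κ = 1 := inv_mul_cancel₀ hκ.ne'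
  have hT1 : ((N + 1 : ℝ) * κ)⁻¹ * (((N + 1 : ℕ) : ℝ) * N * e₁) ≤
      σ ^ 3 * Cg * Cχ * (2 * L * (2 * L) * σS) * ζ := by
    have e : ((N + 1 : ℝ) * κ)⁻¹ * (((N + 1 : ℕ) : ℝ) * N * e₁) =
        (N : ℝ) * hsDiameter σ N ^ 3 * (Cg * Cχ * (2 * L * (2 * L) * σS) * ζ) := by
      rw [he₁]
      push_cast
      calc (((N : ℝ) + 1) * κ)⁻¹ * (((N : ℝ) + 1) * N *
            (Cg * (Cχ * (ζ * hsDiameter σ N ^ 3 * κ * (2 * L * (2 * L) * σS)))))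
          = (((N : ℝ) + 1)⁻¹ * ((N : ℝ) + 1)) * (κ⁻¹ * κ) *
              ((N : ℝ) * hsDiameter σ N ^ 3 * (Cg * Cχ * (2 * L * (2 * L) * σS) * ζ)) := by rw [mul_inv]; ring
        _ = _ := by rw [hcancel, hκc, one_mul, one_mul]
    rw [e]
    calc (N : ℝ) * hsDiameter σ N ^ 3 * (Cg * Cχ * (2 * L * (2 * L) * σS) * ζ)
        ≤ σ ^ 3 * (Cg * Cχ * (2 * L * (2 * L) * σS) * ζ) := mul_le_mul_of_nonneg_right hNε (by positivity)
      _ = _ := by ring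
  have hT2 : ((N + 1 : ℝ) * κ)⁻¹ * (2 * L * 125 * (N + 1 : ℝ) * Cχ * (ζ' + 2 * Cg * P.real (sqDevEvent (N + 1) δ'' r))) =
      κ⁻¹ * (2 * L * 125) * Cχ * (ζ' + 2 * Cg * P.real (sqDevEvent (N + 1) δ'' r)) := by
    set X := ζ' + 2 * Cg * P.real (sqDevEvent (N + 1) δ'' r) with hX
    rw [mul_inv, show ((N : ℝ) + 1)⁻¹ * κ⁻¹ * (2 * L * 125 * ((N : ℝ) + 1) * Cχ * X) =
      (((N : ℝ) + 1)⁻¹ * ((N : ℝ) + 1)) * (κ⁻¹ * (2 * L * 125) * Cχ * X) by ring, hcancel, one_mul]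
  have hT3 : |((N + 1 : ℝ) * κ)⁻¹ * (((N + 1 : ℕ) : ℝ) * N * (g (σ ^ 3) * (Iχ * (Y * hsDiameter σ N ^ 3 * κ * Θb)))) -
      σ ^ 3 * g (σ ^ 3) * Y * Θb * Iχ| ≤ σ ^ 3 / (N + 1 : ℝ) * Cg * Cχ * |Y| * |Θb| := by
    have e : ((N + 1 : ℝ) * κ)⁻¹ * (((N + 1 : ℕ) : ℝ) * N * (g (σ ^ 3) * (Iχ * (Y * hsDiameter σ N ^ 3 * κ * Θb)))) -
        σ ^ 3 * g (σ ^ 3) * Y * Θb * Iχ = -(hsDiameter σ N ^ 3 * (g (σ ^ 3) * Iχ * Y * Θb)) := by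
      set X : ℝ := g (σ ^ 3) * Iχ * Y * Θb * hsDiameter σ N ^ 3 with hX
      have hσ3 : σ ^ 3 = ((N : ℝ) + 1) * hsDiameter σ N ^ 3 := by rw [← hnε]; push_cast; ring
      have h1 : σ ^ 3 * g (σ ^ 3) * Y * Θb * Iχ = ((N : ℝ) + 1) * X := by
        rw [hX]
        calc σ ^ 3 * g (σ ^ 3) * Y * Θb * Iχ = (g (σ ^ 3) * Y * Θb * Iχ) * σ ^ 3 := by ring
          _ = (g (σ ^ 3) * Y * Θb * Iχ) * (((N : ℝ) + 1) * hsDiameter σ N ^ 3) := by rw [← hσ3]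
          _ = _ := by ring
      have h2 : ((N + 1 : ℝ) * κ)⁻¹ * (((N + 1 : ℕ) : ℝ) * N * (g (σ ^ 3) * (Iχ * (Y * hsDiameter σ N ^ 3 * κ * Θb)))) =
          (N : ℝ) * X := by
        rw [hX]
        push_cast
        calc (((N : ℝ) + 1) * κ)⁻¹ * (((N : ℝ) + 1) * N * (g (σ ^ 3) * (Iχ * (Y * hsDiameter σ N ^ 3 * κ * Θb))))
            = (((N : ℝ) + 1)⁻¹ * ((N : ℝ) + 1)) * (κ⁻¹ * κ) *
                ((N : ℝ) * (g (σ ^ 3) * Iχ * Y * Θb * hsDiameter σ N ^ 3)) := by rw [mul_inv]; ring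
          _ = _ := by rw [hcancel, hκc, one_mul, one_mul]
      rw [h1, h2, hX]
      ring
    rw [e, abs_neg, abs_mul, abs_of_nonneg (by positivity : 0 ≤ hsDiameter σ N ^ 3), hε3, abs_mul, abs_mul, abs_mul]
    have h1 : |g (σ ^ 3)| * |Iχ| * |Y| * |Θb| ≤ Cg * Cχ * |Y| * |Θb| :=
      mul_le_mul_of_nonneg_right (mul_le_mul_of_nonneg_right
        (mul_le_mul hgσ hχb (abs_nonneg _) hCg0) (abs_nonneg _)) (abs_nonneg _)
    calc σ ^ 3 / (N + 1 : ℝ) * (|g (σ ^ 3)| * |Iχ| * |Y| * |Θb|) ≤ σ ^ 3 / (N + 1 : ℝ) * (Cg * Cχ * |Y| * |Θb|) :=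
          mul_le_mul_of_nonneg_left h1 (by positivity)
      _ = _ := by ring
  -- conclusion
  rw [hI]
  set M := ∑ i, ∑ j, ∫ z, S1 i j z ∂G with hM
  set E := ∫ z, ∑ i, ∑ j, S2 i j z ∂G with hE
  set B := ((N + 1 : ℕ) : ℝ) * N * (g (σ ^ 3) * (Iχ * (Y * hsDiameter σ N ^ 3 * κ * Θb))) with hB
  have hsplit : ((N + 1 : ℝ) * κ)⁻¹ * (M + E) - σ ^ 3 * g (σ ^ 3) * Y * Θb * Iχ =
      ((N + 1 : ℝ) * κ)⁻¹ * (M - B) + ((N + 1 : ℝ) * κ)⁻¹ * E + (((N + 1 : ℝ) * κ)⁻¹ * B - σ ^ 3 * g (σ ^ 3) * Y * Θb * Iχ) := by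
    ring
  rw [hsplit]
  have hinv0 : 0 ≤ ((N + 1 : ℝ) * κ)⁻¹ := by positivity
  calc |((N + 1 : ℝ) * κ)⁻¹ * (M - B) + ((N + 1 : ℝ) * κ)⁻¹ * E + (((N + 1 : ℝ) * κ)⁻¹ * B - σ ^ 3 * g (σ ^ 3) * Y * Θb * Iχ)|
      ≤ |((N + 1 : ℝ) * κ)⁻¹ * (M - B)| + |((N + 1 : ℝ) * κ)⁻¹ * E| + |((N + 1 : ℝ) * κ)⁻¹ * B - σ ^ 3 * g (σ ^ 3) * Y * Θb * Iχ| :=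
        (abs_add_le _ _).trans (add_le_add (abs_add_le _ _) le_rfl)
    _ ≤ ((N + 1 : ℝ) * κ)⁻¹ * (((N + 1 : ℕ) : ℝ) * N * e₁) +
        ((N + 1 : ℝ) * κ)⁻¹ * (2 * L * 125 * (N + 1 : ℝ) * Cχ * (ζ' + 2 * Cg * P.real (sqDevEvent (N + 1) δ'' r))) +
        σ ^ 3 / (N + 1 : ℝ) * Cg * Cχ * |Y| * |Θb| := by
        refine add_le_add (add_le_add ?_ ?_) hT3
        · rw [abs_mul, abs_of_nonneg hinv0]
          exact mul_le_mul_of_nonneg_left hmain hinv0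
        · rw [abs_mul, abs_of_nonneg hinv0]
          exact mul_le_mul_of_nonneg_left herr hinv0
    _ ≤ _ := by rw [hT2]; exact add_le_add (add_le_add hT1 le_rfl) le_rfl

/-! ## The bookkeeping of thresholds: the fixed-time tube mean, uniformly on `[0, τ]` -/

/-- **The collision-tube side of the Enskog closure at rung 0 has the Enskog mean at each fixed time,
uniformly on `[0, τ]`, conditionally on the canonical contact theorem — for every continuous mark `Ξ` with
`|Ξ| ≤ 2L` vanishing at relative speed `≥ 2L`** (the bookkeeping of thresholds behind the sibling crux's
helper stub `stub_tubeMeanRung0OfContact`, mark-generic): given the contact theorem in phase-space form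
(antecedent), for `σ < σ₀`, `κ < κ₀(η)` and `N ≥ N₀(κ, η)`,
`|E_{G_N} A_t − σ³ g(σ³) Y(σ³) Θ̄_Ξ ∫χ(t,·)| ≤ η/τ` for every `t ∈ [0, τ]`
(`abs_integral_tubeStat_sub_le_of_speedCutoff`; `χ` is bounded on `[0, τ] × 𝕋³`, `g` on `[0, ∞)`, the accuracy
`ζ` of the contact theorem, the shell width `δ = 2Lκ`, the continuity modulus of `g` at `σ³`, the uniform
density LLN, the `O(1/N)` term). [cite: CIPDiluteGases1994, §2.2] -/
theorem forall_abs_integral_tubeStat_sub_le_of_contact :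
    (∃ σ₁ : ℝ, 0 < σ₁ ∧ ∀ σ : ℝ, 0 < σ → σ < σ₁ → ∀ ζ : ℝ, 0 < ζ → ∃ δ₁ : ℝ, 0 < δ₁ ∧ ∀ δ : ℝ, 0 < δ → δ ≤ δ₁ →
      ∃ N₀ : ℕ, ∀ N : ℕ, N₀ ≤ N → ∀ (a θ : ℝ) (u : V3), 0 < a → 0 < θ →
      ∀ Φ : HardSphereFlow (Torus.geometry (Fin 3)) (hsDiameter σ N) (N + 1),
      ∀ i j : Fin (N + 1), i ≠ j → ∀ S : Set V3, MeasurableSet S → S ⊆ {q | 1 < ‖q‖ ∧ ‖q‖ ≤ 1 + δ} →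
        |(localGibbsLaw σ (fun _ => a) (fun _ => u) (fun _ => θ) N Φ).real
            {z | Torus.reprSym ((z i).1 - (z j).1) ∈ hsDiameter σ N • S}
          - contactValue (σ ^ 3) * hsDiameter σ N ^ 3 * (volume S).toReal|
          ≤ ζ * hsDiameter σ N ^ 3 * (volume S).toReal) →
    ∃ η₁ : ℝ, 0 < η₁ ∧ ∃ σ₀ : ℝ, 0 < σ₀ ∧ ∀ (σ a θ : ℝ) (u : V3) (τ : ℝ) (χ : ℝ × UnitAddTorus (Fin 3) → ℝ)
      (g : ℝ → ℝ) (L r : ℝ) (Ξ : V3 × V3 × V3 → ℝ),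
      0 < σ → σ < σ₀ → σ ^ 3 < η₁ → 0 < a → 0 < θ → 0 < τ → Continuous χ → Continuous g →
      (∀ b, η₁ ≤ b → g b = 0) → 1 ≤ L → 0 < r → r < 1 / 4 →
      Continuous Ξ → (∀ p, |Ξ p| ≤ 2 * L) → (∀ m v v' : V3, 2 * L ≤ ‖v - v'‖ → Ξ (m, v, v') = 0) →
      ∀ η : ℝ, 0 < η → ∃ κ₀ : ℝ, 0 < κ₀ ∧ ∀ κ : ℝ, 0 < κ → κ < κ₀ →
      ∀ Φ : (N : ℕ) → HardSphereFlow (Torus.geometry (Fin 3)) (hsDiameter σ N) (N + 1), ∃ N₀ : ℕ, ∀ N : ℕ, N₀ ≤ N →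
      ∀ t ∈ Set.Icc (0 : ℝ) τ,
        |(∫ z, tubeStat σ N χ g Ξ r r 1 κ t z ∂(localGibbsLaw σ (fun _ => a) (fun _ => u) (fun _ => θ) N (Φ N)))
          - σ ^ 3 * g (σ ^ 3) * contactValue (σ ^ 3) *
            (∫ p : V3 × V3, sphereMark Ξ p.1 p.2 * (localMaxwellian 1 θ u p.1 * localMaxwellian 1 θ u p.2)) *
            ∫ x : UnitAddTorus (Fin 3), χ (t, x)| ≤ η / τ := by
  intro hContact
  -- two elementary facts: `K · (η / (4 (K + 1))) ≤ η / 4`; a continuous cutoff function is bounded on `[0, ∞)`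
  have hmul4 : ∀ {K η' : ℝ}, 0 ≤ K → 0 ≤ η' → K * (η' / (4 * (K + 1))) ≤ η' / 4 := by
    intro K η' hK hη'
    rw [mul_div_assoc', div_le_div_iff₀ (by positivity) (by positivity)]
    nlinarith
  have hcut : ∀ {g : ℝ → ℝ}, Continuous g → (∀ b, (1 : ℝ) ≤ b → g b = 0) →
      ∃ C : ℝ, 0 ≤ C ∧ ∀ y, 0 ≤ y → |g y| ≤ C := by
    intro g hg hg0
    obtain ⟨C, hC⟩ := (isCompact_Icc (a := (0 : ℝ)) (b := 1)).exists_bound_of_continuousOn hg.continuousOn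
    refine ⟨C, (norm_nonneg _).trans (hC 0 ⟨le_rfl, zero_le_one⟩), fun y hy => ?_⟩
    by_cases h1 : y ≤ 1
    · simpa only [Real.norm_eq_abs] using hC y ⟨hy, h1⟩
    · rw [hg0 y (le_of_not_ge h1), abs_zero]
      exact (norm_nonneg _).trans (hC 0 ⟨le_rfl, zero_le_one⟩)
  obtain ⟨σ₁, hσ₁, HC⟩ := hContact
  obtain ⟨σᵤ, hσᵤ, Hsmall⟩ := exists_smallDensity uniformProfile (m := 1) one_pos
  refine ⟨1, one_pos, min σ₁ σᵤ, lt_min hσ₁ hσᵤ, ?_⟩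
  intro σ a θ u τ χ g L r Ξ hσ hσ0 _hσ31 ha hθ hτ hχ hg hg0 hL hr hr4 hΞc hΞb hΞL η hη
  have hσ1 : σ < σ₁ := lt_of_lt_of_le hσ0 (min_le_left _ _)
  have hσu : σ < σᵤ := lt_of_lt_of_le hσ0 (min_le_right _ _)
  have hsd : SmallDensity uniformProfile σ := (Hsmall σ hσ hσu).1
  have hσhalf : σ ≤ 1 / 2 := hsd.σ_lt_half.le
  have hL0 : (0 : ℝ) ≤ L := zero_le_one.trans hL
  have hLpos : (0 : ℝ) < L := zero_lt_one.trans_le hL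
  have hr2 : r < 1 / 2 := by linarith
  -- bounds for `χ` on `[0, τ] × 𝕋³` and for `g` on `[0, ∞)`
  obtain ⟨Cχ, hCχ⟩ := (isCompact_Icc.prod isCompact_univ).exists_bound_of_continuousOn
    (s := Set.Icc (0 : ℝ) τ ×ˢ (univ : Set (UnitAddTorus (Fin 3)))) hχ.continuousOn
  have hχb : ∀ t ∈ Set.Icc (0 : ℝ) τ, ∀ x : UnitAddTorus (Fin 3), |χ (t, x)| ≤ Cχ := fun t ht x => by
    simpa only [Real.norm_eq_abs] using hCχ (t, x) ⟨ht, mem_univ _⟩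
  have hCχ0 : 0 ≤ Cχ := (abs_nonneg _).trans (hχb 0 ⟨le_rfl, hτ.le⟩ 0)
  obtain ⟨Cg, hCg0, hCgb⟩ := hcut hg hg0
  -- constants of the fixed-time estimate
  set σS : ℝ := (sphereMeasure : Measure (Metric.sphere (0 : V3) 1)).real univ with hσS
  have hσS0 : 0 ≤ σS := measureReal_nonneg
  set Θb : ℝ := ∫ p : V3 × V3, sphereMark Ξ p.1 p.2 *
    (localMaxwellian 1 θ u p.1 * localMaxwellian 1 θ u p.2) with hΘb
  set Y : ℝ := contactValue (σ ^ 3) with hY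
  -- (1) the accuracy of the contact theorem
  set K₁ : ℝ := τ * (σ ^ 3 * Cg * Cχ * (2 * L * (2 * L) * σS)) with hK₁
  have hK₁0 : 0 ≤ K₁ := by positivity
  set ζ : ℝ := η / (4 * (K₁ + 1)) with hζ
  have hζpos : 0 < ζ := by positivity
  have hζK : K₁ * ζ ≤ η / 4 := hmul4 hK₁0 hη.le
  obtain ⟨δ₁, hδ₁, Hδ⟩ := HC σ hσ hσ1 ζ hζpos
  -- (2) the flight-time window
  refine ⟨min (δ₁ / (2 * L)) (1 / (2 * L)), lt_min (by positivity) (by positivity), ?_⟩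
  intro κ hκ hκ0 Φ
  have h2L : (0 : ℝ) < 2 * L := by positivity
  have hκδ : 2 * L * κ ≤ δ₁ := by
    have h := (lt_of_lt_of_le hκ0 (min_le_left _ _)).le
    rwa [le_div_iff₀ h2L, mul_comm] at h
  have hκ1 : 2 * L * κ ≤ 1 := by
    have h := (lt_of_lt_of_le hκ0 (min_le_right _ _)).le
    rwa [le_div_iff₀ h2L, mul_comm] at h
  have hδpos : 0 < 2 * L * κ := by positivity
  obtain ⟨N₁, HN₁⟩ := Hδ (2 * L * κ) hδpos hκδ
  -- (3) the density-weight replacement: accuracy `ζ'` and the continuity modulus of `g` at `σ³`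
  set K₂ : ℝ := τ * (κ⁻¹ * (2 * L * 125) * Cχ) with hK₂
  have hK₂0 : 0 ≤ K₂ := by positivity
  set ζ' : ℝ := η / (4 * (K₂ + 1)) with hζ'
  have hζ'pos : 0 < ζ' := by positivity
  have hζ'K : K₂ * ζ' ≤ η / 4 := hmul4 hK₂0 hη.le
  obtain ⟨δg, hδg, Hg⟩ := Metric.continuous_iff.1 hg (σ ^ 3) ζ' hζ'pos
  have hσ3 : 0 < σ ^ 3 := by positivity
  set δ'' : ℝ := δg / σ ^ 3 with hδ''
  have hδ''pos : 0 < δ'' := by positivity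
  have hmod : ∀ y, 0 ≤ y → |y - 1| < δ'' → |g (σ ^ 3 * y) - g (σ ^ 3)| ≤ ζ' := by
    intro y _ hy
    have hd : dist (σ ^ 3 * y) (σ ^ 3) < δg := by
      rw [Real.dist_eq, show σ ^ 3 * y - σ ^ 3 = σ ^ 3 * (y - 1) by ring, abs_mul, abs_of_pos hσ3]
      calc σ ^ 3 * |y - 1| < σ ^ 3 * δ'' := mul_lt_mul_of_pos_left hy hσ3
        _ = δg := by rw [hδ'']; field_simp
    have := Hg _ hd
    rw [Real.dist_eq] at this
    exact this.le
  -- (4) the bad density event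
  set K₃ : ℝ := τ * (κ⁻¹ * (2 * L * 125) * Cχ * (2 * Cg)) with hK₃
  have hK₃0 : 0 ≤ K₃ := by positivity
  obtain ⟨N₂, HN₂⟩ := exists_posGibbs_sqDevEvent_le hsd ha hr hr2 hδ''pos (η := η / (4 * (K₃ + 1))) (by positivity)
  -- (5) the `O(1/N)` term
  set K₄ : ℝ := τ * (σ ^ 3 * Cg * Cχ * |Y| * |Θb|) with hK₄
  have hK₄0 : 0 ≤ K₄ := by positivity
  set N₃ : ℕ := Nat.ceil (4 * K₄ / η) with hN₃
  refine ⟨max (max N₁ 1) (max N₂ N₃), fun N hN t ht => ?_⟩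
  have hN1 : N₁ ≤ N := ((le_max_left _ _).trans (le_max_left _ _)).trans hN
  have hNone : 1 ≤ N := ((le_max_right _ _).trans (le_max_left _ _)).trans hN
  have hN2 : N₂ ≤ N := ((le_max_left _ _).trans (le_max_right _ _)).trans hN
  have hN3 : N₃ ≤ N := ((le_max_right _ _).trans (le_max_right _ _)).trans hN
  have hK₄N : K₄ / ((N : ℝ) + 1) ≤ η / 4 := by
    have hc : 4 * K₄ / η ≤ (N₃ : ℝ) := Nat.le_ceil _
    have hN3' : (N₃ : ℝ) ≤ N := by exact_mod_cast hN3
    rw [div_le_div_iff₀ (by positivity) (by positivity)]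
    rw [div_le_iff₀ hη] at hc
    nlinarith
  -- the fixed-time estimate
  set G := localGibbsLaw σ (fun _ => a) (fun _ => u) (fun _ => θ) N (Φ N) with hG
  set PBad : ℝ := (posGibbsMeasure (fun _ : T3 => a) (hsDiameter σ N) (N + 1)).real (sqDevEvent (N + 1) δ'' r)
    with hPBad
  have hPBad0 : 0 ≤ PBad := measureReal_nonneg
  have hPBadle : PBad ≤ η / (4 * (K₃ + 1)) := HN₂ N hN2
  set B : ℝ := σ ^ 3 * Cg * Cχ * (2 * L * (2 * L) * σS) * ζ + κ⁻¹ * (2 * L * 125) * Cχ * (ζ' + 2 * Cg * PBad)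
    + σ ^ 3 / (N + 1 : ℝ) * Cg * Cχ * |Y| * |Θb| with hB
  have hC_N : ∀ i j : Fin (N + 1), i ≠ j → ∀ S : Set V3, MeasurableSet S →
      S ⊆ {q | 1 < ‖q‖ ∧ ‖q‖ ≤ 1 + 2 * L * κ} →
      |G.real {z | Torus.reprSym ((z i).1 - (z j).1) ∈ hsDiameter σ N • S}
        - contactValue (σ ^ 3) * hsDiameter σ N ^ 3 * (volume S).toReal|
        ≤ ζ * hsDiameter σ N ^ 3 * (volume S).toReal :=
    fun i j hij S hS hSδ => HN₁ N hN1 a θ u ha hθ (Φ N) i j hij S hS hSδ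
  have hpt : |(∫ z, tubeStat σ N χ g Ξ r r 1 κ t z ∂G) -
        σ ^ 3 * g (σ ^ 3) * Y * Θb * ∫ x : UnitAddTorus (Fin 3), χ (t, x)| ≤ B :=
    abs_integral_tubeStat_sub_le_of_speedCutoff (Φ N) hsd hNone ha hθ hχ (hχb t ht) hg hCgb hΞc hΞb hΞL hL0 hκ
      hζpos.le hζ'pos.le hδ''pos le_rfl hκ1 hr hmod hC_N
  -- `τ · B ≤ η`
  have hτB : B * τ ≤ η := by
    have e : B * τ = K₁ * ζ + K₂ * ζ' + K₃ * PBad + K₄ / ((N : ℝ) + 1) := by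
      rw [hB, hK₁, hK₂, hK₃, hK₄]; ring
    rw [e]
    have h3 : K₃ * PBad ≤ η / 4 := (mul_le_mul_of_nonneg_left hPBadle hK₃0).trans (hmul4 hK₃0 hη.le)
    linarith
  have hBτ : B ≤ η / τ := by rw [le_div_iff₀ hτ]; exact hτB
  exact hpt.trans hBτ

/-! ## Time integration of a bound uniform on `[0, τ]` -/

/-- `|∫_{[0,τ]} f − c ∫_{[0,τ]} h| ≤ B τ` when `|f(t) − c h(t)| ≤ B` on `[0, τ]` and both are integrable there.
[folklore] -/
theorem abs_setIntegral_sub_mul_setIntegral_le_of_forall {f h : ℝ → ℝ} {τ c B : ℝ} (hτ : 0 ≤ τ)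
    (hfi : IntegrableOn f (Set.Icc (0 : ℝ) τ)) (hhi : IntegrableOn h (Set.Icc (0 : ℝ) τ))
    (hpt : ∀ t ∈ Set.Icc (0 : ℝ) τ, |f t - c * h t| ≤ B) :
    |(∫ t in Set.Icc (0 : ℝ) τ, f t) - c * ∫ t in Set.Icc (0 : ℝ) τ, h t| ≤ B * τ := by
  rw [← integral_const_mul, ← integral_sub hfi (hhi.const_mul _)]
  have h := norm_setIntegral_le_of_norm_le_const (μ := (volume : Measure ℝ)) (s := Set.Icc (0 : ℝ) τ) (C := B)
    (f := fun t => f t - c * h t) measure_Icc_lt_top (fun t ht => by rw [Real.norm_eq_abs]; exact hpt t ht)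
  rw [Real.norm_eq_abs, Real.volume_real_Icc_of_le hτ, sub_zero] at h
  exact h

/-- For a continuous `χ : ℝ × 𝕋³ → ℝ` the space average `t ↦ ∫ χ(t, ·)` is integrable on `[0, τ]`. [folklore] -/
theorem integrableOn_integral_of_continuous {χ : ℝ × UnitAddTorus (Fin 3) → ℝ} (hχ : Continuous χ) (τ : ℝ) :
    IntegrableOn (fun t : ℝ => ∫ x : UnitAddTorus (Fin 3), χ (t, x)) (Set.Icc (0 : ℝ) τ) := by
  obtain ⟨Cχ, hCχ⟩ := (isCompact_Icc.prod isCompact_univ).exists_bound_of_continuousOn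
    (s := Set.Icc (0 : ℝ) τ ×ˢ (univ : Set (UnitAddTorus (Fin 3)))) hχ.continuousOn
  have hχb : ∀ t ∈ Set.Icc (0 : ℝ) τ, ∀ x : UnitAddTorus (Fin 3), |χ (t, x)| ≤ Cχ := fun t ht x => by
    simpa only [Real.norm_eq_abs] using hCχ (t, x) ⟨ht, mem_univ _⟩
  have hhm : StronglyMeasurable fun t : ℝ => ∫ x : UnitAddTorus (Fin 3), χ (t, x) := by
    have hu : StronglyMeasurable (Function.uncurry fun (t : ℝ) (x : UnitAddTorus (Fin 3)) => χ (t, x)) := by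
      have h := hχ.measurable.stronglyMeasurable
      exact h
    exact hu.integral_prod_right'
  have hhb : ∀ t ∈ Set.Icc (0 : ℝ) τ, ‖∫ x : UnitAddTorus (Fin 3), χ (t, x)‖ ≤ Cχ := by
    intro t ht
    have h := norm_integral_le_of_norm_le_const (μ := (volume : Measure (UnitAddTorus (Fin 3)))) (C := Cχ)
      (f := fun x => χ (t, x)) (ae_of_all _ fun x => by rw [Real.norm_eq_abs]; exact hχb t ht x)
    simpa only [probReal_univ, mul_one] using h
  exact Measure.integrableOn_of_bounded measure_Icc_lt_top.ne hhm.aestronglyMeasurable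
    ((ae_restrict_mem measurableSet_Icc).mono hhb)

end Literature.MathematicalPhysics.KineticTheory

end
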